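import Literature.MathematicalPhysics.QuantumFieldTheory.Balaban1983to89.B10Eq61DetPositive
import Literature.Analysis.Matrix.DeterminantNormBound
import Literature.MathematicalPhysics.QuantumFieldTheory.Balaban1983to89.B10Eq35Norm
import Literature.MathematicalPhysics.QuantumFieldTheory.Balaban1983to89.B10Eq65PolymerSum

/-!
# Balaban, CMP 102 (1985) [B10] p. 271 «the sum of terms −log det S(V_k^{(k)}, b₀(c)) … analyzed in the same way as the
perturbative expressions»: THE SIZE OF THE LOCAL TERM — `−log det S(V₀, b₀(c))|_𝔤 = (d − 1)·dim 𝔤·log L − log det W`,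
`|log det W| ≤ dim 𝔤·θ/(1 − θ)`, `θ = 50(d+1)εL^{d} = O(L^{d+2}α₀)`

statement-level skeleton of published theorems with citation tags; proofs where landed; nothing here is a claim about
the Yang–Mills mass gap

PRINT ([B10] = Balaban1985UV3, p. 271, after (62); render `b2b-balaban-ref1/pages/1985-cmp102-uv-stability-3d/…-p017-x2.png`
READ AS IMAGE by this seat, 2026-08-23): «To complete the proof of the inductive assumption (41) we have to expand the term
(61) analogously to (60). It can be localized in a similar way, although a bit more complicated, as the perturbative
expressions. … The elimination yields also a sum of local terms determined by the coefficient at the variable A(b₀(c)) in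
(QA)(c). More exactly the coefficient is a linear operator S(V_k^{(k)}, b₀(c)) acting on the Lie algebra 𝔤, see the
formula (124) [4] for a precise definition, and we obtain the sum of terms −log det S(V_k^{(k)}, b₀(c)). They are simple,
local, gauge invariant functions of V_k^{(k)} = Ū^k_{k+1}, and are analyzed in the same way as the perturbative
expressions.»; (61) p. 271 «log Z^{(k)}(B(Λ_{k+1}), U_{k+1}) − log Z^{(k)}(B(Λ_{k+1}), 1)»; p. 271 «Its logarithm is equal
to a sum of an absolute constant, cancelled by the same constant from the second term in (61), and …».  [4] =
Balaban1985Averaging p. 36: (124) the five-term linear form, (125) «the main term in this linear form», (126) and «the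
operators occurring in these terms can be estimated by O(L²α₀)»; Proposition 3 p. 36 «c₃ depends on d and L»;
Proposition 1 p. 26 / (44) p. 24 (plaquette regularity `|V₀(∂p) − 1| ≦ α₀` ⇒ block loops within `O(L²α₀)` of `1`).

WHAT THE TREE HAD (all BY NAME, nothing restated).  r07's `B10Eq61SpineCoefficient` (the full `b₀(c)`-coefficient
`S = fullCoeffOn` on an `S`-stable finite-dimensional real `𝔤 ⊂ 𝔸`, its main term `S₀ = mainCoeffOn = L^{−d}·R(u)|_𝔤`,
`u = V₀([c₋, b₀(c)₋])` the spine transporter, the explicit (126) `norm_fullCoeff_sub_smul_mainCoeff_le`: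
`‖SX − L·S₀X‖ ≦ 50(d+1)εL‖X‖` at a background whose block loops at `c` satisfy `‖W_x(V₀) − 1‖ ≦ ε ≦ 1/8`, the flat value
`fullCoeff_one`: `S(1, b₀(c)) = L^{1−d}·id`, `|det R(u)|_𝔤| = 1` `abs_det_conjROn`, gauge invariance of `|det S|`
`abs_det_fullCoeffOn_gaugeAct`); r07's `B10Eq61DetPositive` (`det_mainCoeffOn_eq`: `det S₀ = L^{−d·dim 𝔤}·det R(u)|_𝔤`;
for `H = e^𝔤`: `det S > 0`, `neg_log_det_fullCoeffOn_eq`: `−log det S = −log|det S|`); b07's Proposition 1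
`B7Prop2Explicit.norm_Wcx_sub_one_le`; `B8Ineq130.Wcx_one` / `hol_one` (the flat background); and the summit-lit lineage's
Haar-measure determinant bounds `Literature.Analysis.Matrix.DeterminantNormBound.abs_det_le_norm_pow` (`|det A| ≦ ‖A‖ⁿ`,
ANY norm) / `abs_det_inv_le_norm_symm_pow` (`|det A|⁻¹ ≦ ‖A⁻¹‖ⁿ`).

WHAT THIS FILE ADDS (theorems + ONE definition with body, `relCoeffOn`; 0 named facts, 0 `sorry`):
* §1 [folklore] ON A FINITE-DIMENSIONAL REAL NORMED SPACE, ANY NORM: if `‖Wx − x‖ ≦ θ‖x‖` with `0 ≦ θ < 1` then `W` is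
  bijective, **`(1 − θ)^{dim} ≦ det W ≦ (1 + θ)^{dim}`** (`det_bounds_of_sub_id`, from the two Haar-measure bounds),
  **`0 < det W`** (`det_pos_of_sub_id`: intermediate value theorem along `1 + t(W − 1)`), hence
  **`|log det W| ≦ dim·log(1/(1 − θ)) ≦ dim·θ/(1 − θ)`** (`abs_log_det_le_of_sub_id`, `abs_log_det_le_div_of_sub_id`).
* §2 def **`relCoeffOn`** = THE RELATIVE COEFFICIENT `W(V₀, b₀(c)) := (L·S₀)⁻¹ ∘ S = L⁻¹L^{d}·R(u⁻¹)|_𝔤 ∘ S|_𝔤`;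
  **`smul_mainCoeffOn_comp_relCoeffOn`** (`S = L·S₀ ∘ W` EXACTLY), `det_fullCoeffOn_eq_mul_det_relCoeffOn`
  (`det S = L^{dim 𝔤}·L^{−d·dim 𝔤}·det R(u)|_𝔤·det W`), **`norm_relCoeffOn_sub_le`** (`‖WX − X‖ ≦ 50(d+1)εL^{d}‖X‖` —
  (126) transported by the isometry `L⁻¹L^{d}R(u⁻¹)`).
* §3 `theta_lt_one(_iff)` (the §9d window `50(d+1)ε < L^{−d}` of `B10Eq61SpineCoefficient` IS `θ := 50(d+1)εL^{d} < 1`),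
  **`det_relCoeffOn_pos`**, **`det_relCoeffOn_bounds`**, `abs_log_det_relCoeffOn_le(_div)`.
* §4 **`neg_log_abs_det_fullCoeffOn_eq`**: `−log|det S(V₀, b₀(c))|_𝔤 = (d − 1)·dim 𝔤·log L − log det W(V₀, b₀(c))` for
  EVERY `H ≦ U1`-valued regular background (no `e^𝔤` hypothesis: `|det R(u)| = 1` and `det W > 0`);
  **`abs_neg_log_abs_det_fullCoeffOn_sub_le(_div)`**: `|−log|det S| − (d − 1)·dim 𝔤·log L| ≦ dim 𝔤·log(1/(1 − θ)) ≦
  dim 𝔤·θ/(1 − θ)`; for `H = e^𝔤` ([4] p. 20) the same for `−log det S` itself (`neg_log_det_fullCoeffOn_eq_sub`,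
  **`abs_neg_log_det_fullCoeffOn_sub_le_div`**).
* §5 THE FLAT BACKGROUND: `norm_Wcx_one_sub_one(_le)` (`< 1` is NE7c's `B7Prop3GeneralTild.loops_flat`), `fullCoeff_one_mem`, **`relCoeffOn_one`** (`W(1, b₀(c)) = 1`),
  `det_relCoeffOn_one`, **`neg_log_abs_det_fullCoeffOn_one`** (`−log|det S(1, b₀(c))|_𝔤 = (d − 1)·dim 𝔤·log L`
  EXACTLY — the constant carried by the second term of (61)), **`neg_log_abs_det_sub_flat_eq`** (the (61)-difference of
  the local terms at one coarse bond `= −log det W(V₀, b₀(c))`: the constant cancels against the second term of (61) —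
  the analogue, for the local terms, of what print says of the Gaussian integral's absolute constant, «cancelled by the
  same constant from the second term in (61)» [v1.2 wording, second reader's L-41]) and
  `abs_neg_log_abs_det_sub_flat_le_div` (`≦ dim 𝔤·θ/(1 − θ)`).
* §6 UNDER THE PLAQUETTE REGULARITY (44): `c3_window` (the `c₃` window `α₀ < L^{−(d+2)}/(800(d+1)²(d+4))` of
  `fullCoeff_injective_of_c3` gives Proposition 1's hypotheses and `θ = 800(d+1)²(d+4)L^{d+2}α₀ < 1`),
  **`abs_neg_log_abs_det_fullCoeffOn_sub_le_of_plaquette`** (`|−log|det S| − (d − 1)·dim 𝔤·log L| ≦ dim 𝔤·θ/(1 − θ)`,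
  `θ = 800(d+1)²(d+4)L^{d+2}α₀`), `norm_Wcx_sub_one_lt_one_of_plaquette`.
* §7 **`abs_sum_neg_log_abs_det_sub_flat_le`**: over a finite set of coarse bonds the (61)-difference of «the sum of terms
  −log det S(V_k^{(k)}, b₀(c))» is at most `dim 𝔤·θ/(1 − θ)` per bond (the `Σ_c` of `B10Eq61EliminationTerms`).
* §8 `gaugeAct_mem_subgroup`, **`det_relCoeffOn_gaugeAct`** (`det W`, the background-dependent part of the local term, is
  gauge invariant).
* §9 `G = U(N)`, `𝔤 = 𝔲(N)`: **`abs_neg_log_det_fullCoeffOn_sub_le_div_unitary`** — every hypothesis about `𝔤` and `G`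
  discharged by name (`fullCoeff_mem_skewAdjoint`, (23) of [4] `exists_skewAdjoint_expUnit_eq`, the `U(N)` log-chart).
* §10 [v1.1] IN THE LETTERS OF (61): **`abs_logZ_sub_logZ_sub_bracket_le`** — for the two constrained normalisations of
  (61) whose `κ`-blocks are block-diagonal over the coarse bonds with blocks the matrices of the FULL coefficients
  `S(U_{k+1}, b₀(c))`, `S(1, b₀(c))`: `|[log Z^{(k)}(·,U_{k+1}) − log Z^{(k)}(·,1)] − [Gaussian bracket]| ≦ |o|·dim 𝔤·θ/(1 − θ)`
  (`B10Eq61EliminationTerms.logZ_sub_logZ_eq` + §7; the split's invertibility hypotheses `hκ` derived from `det S ≠ 0`) —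
  the companion of `B10Eq61SpineCoefficient.logZ_sub_logZ_eq_of_mainCoeffOn_blocks` (main-term blocks: bracket exact).
* §11 [v1.2] **`abs_neg_log_det_fullCoeffOn_sub_le_div_of_logChart`** (every log-charted gauge group `G = e^𝔤`, p24's
  `LogChart`: `h𝔤`, `hst`, `hE` by `B10Eq61CoefficientOnLie`) and **`abs_neg_log_det_fullCoeffOn_sub_le_div_specialUnitary`**
  (`G = SU(N)`, print's semi-simple compact case, [B10] Thm. 1; positivity by `B10Eq61DetPositive.det_fullCoeffOn_pos_specialUnitary`).
* §12 [v1.3] THE SIZE OF `log Z^{(k)}(·, U)` ITSELF ((62) p. 271, p. 273 «we get easily |E^{(j)}| ≦ O(1)|T₁^{(j)}|»):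
  **`logZ_flat_eq`** (`log Z^{(k)}(·, 1) = (r/2)·log 2π + ½·log det(C₀*Δ_k(1)C₀)⁻¹ + |o|·(d − 1)·dim 𝔤·log L` EXACTLY),
  **`abs_logZ_flat_le`** (`γ₀·1 ⪯ C₀*Δ_k(1)C₀ ⪯ γ₁·1`, `γ₀ > 0` — [5] (3.157) — give
  `|log Z^{(k)}(·, 1)| ≦ r·½(log 2π + max(|log γ₀|, |log γ₁|)) + |o|·|(d − 1)·dim 𝔤·log L|`,
  `B10Eq35Norm.abs_log_det_le_of_form_bounds` by name), `abs_logZ_flat_le_sites` (the shape of the `hZ` leaf of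
  `B10Eq65PolymerSum.logZT_le_of_gaussian` with the elimination share DERIVED), **`abs_logZ_le`** (regular background `U`:
  `+ |o|·dim 𝔤·θ/(1 − θ)`).
* §13 [v1.4] KNIT TO THE `hZ` LEAF OF (65) BY NAME: `abs_log_abs_det_fullCoeffOn_le` (per coarse bond
  `|log|det S(V₀, b₀(c))|_𝔤| ≦ |(d − 1)·dim 𝔤·log L| + dim 𝔤·θ/(1 − θ)`),
  **`logZ_eq_J_add_log_gaussian`** (`log Z^{(k)}(·, U) = J + log ∫ e^{−½⟨v, C₁*Δ_k(U)C₁v⟩}dv`, `J = −Σ_c log|det S(U, b₀(c))|`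
  — the hypothesis `hZ` of `B10Eq65PolymerSum.logZT_le_of_gaussian` PRODUCED), **`abs_sum_log_abs_det_fullCoeffOn_le`**
  (`|J| ≦ |o|·(|(d − 1)·dim 𝔤·log L| + dim 𝔤·θ/(1 − θ))` — its `hJ` PRODUCED), **`abs_logZ_le_sites_of_leaf`** (the volume law
  for `log Z^{(k)}(·, U)` re-derived THROUGH that leaf: `|log Z^{(k)}(T, U)| ≦ (c_T·u + c_o·(|(d − 1)·dim 𝔤·log L| +
  dim 𝔤·θ/(1 − θ)))·|T|`); + one import `B10Eq65PolymerSum`.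

HONEST SCOPE.  (i) Print's «analyzed in the same way as the perturbative expressions» refers to the expansion and
localization scheme (60)/(30)–(33) (expansion in `ℋ(B)` and `B` up to sixth order, exponential decay of propagators);
that scheme is NOT reproduced here.  What is derived is the ZEROTH-ORDER term of the local term (its flat value
`(d − 1)·dim 𝔤·log L`, exactly cancelling in (61)) and a UNIFORM BOUND of the remainder `−log det W(V₀, b₀(c))` by
`dim 𝔤·θ/(1 − θ)`, `θ = 50(d+1)εL^{d}` (`= 800(d+1)²(d+4)L^{d+2}α₀` under (44)) — i.e. the local Jacobian terms of (61)
are of first order in the block-loop regularity of the background, the size of small-field perturbative terms; the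
analytic dependence of `det W` on the background and its Taylor coefficients are not treated.  (ii) Hypotheses exactly
those of `B10Eq61SpineCoefficient` §9d / `B10Eq61DetPositive` §3 (background with values in a subgroup `H ≦ U1 𝔸` under
whose rotations `𝔤` is stable, block loops at `c` within `ε ≦ 1/8`, `50(d+1)ε < L^{−d}`, `S𝔤 ⊆ 𝔤` as the hypothesis `h𝔤`
— supplied for log-charted groups by `B10Eq61CoefficientOnLie`); `ℤ^d` carrier, one averaging step (HONEST SCOPE (ii)
there).  (iii) The constants `50(d+1)`, `16(d+1)(d+4)`, `800(d+1)²(d+4)` are the lineage's explicit versions of print's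
`O(L²α₀)` / `c₃(d, L)`; print displays no constant.  (iv) KIND (G.5-54 [i]): derived member over the lineage's concrete
objects; row B10.Eq61 (member), xref B10.Eq63 leaf E63 → X13 «(124) [4]».  Unit `lit-balaban-r07` gen 37 (v1;
v1.1 = v1 + §10 APPEND-ONLY, same seat, every v1 declaration unchanged, no new import; v1.2 = v1.1 + §11 APPEND-ONLY +
the second reader's L-41 attribution wording in three docstrings — every declaration's statement and proof unchanged;
v1.3 = v1.2 + `import …B10Eq35Norm` + §12 APPEND-ONLY — every v1.2 declaration's statement and proof unchanged;
v1.4 = v1.3 + `import …B10Eq65PolymerSum` + §13 APPEND-ONLY + the B7 brief owner's [R04-G37-CITELOC] locator correction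
«Proposition 1 p.26» (was p.24) in two cite tags and the header — every v1.3 declaration's statement and proof unchanged).
NOT summit progress.
-/

noncomputable section

open scoped BigOperators
open Module

namespace Literature.MathematicalPhysics.QuantumFieldTheory.Balaban1983to89.B10Eq61LocalTermSize

/-! ## §1 [folklore] The determinant of a perturbation of the identity on a finite-dimensional real normed space, ANY norm
(linear algebra behind print's «−log det S(V_k^{(k)}, b₀(c))»; our proofs, tagged by their locus of use) -/

section Folklore

variable {E : Type*} [NormedAddCommGroup E] [NormedSpace ℝ E]

/-- `‖Wx‖ ≤ (1 + θ)‖x‖` when `‖Wx − x‖ ≤ θ‖x‖`. [folklore] [cite: Balaban1985UV3, p.271 (after (62))] -/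
theorem norm_apply_le_of_sub_id {W : E →ₗ[ℝ] E} {θ : ℝ} (hW : ∀ x, ‖W x - x‖ ≤ θ * ‖x‖) (x : E) :
    ‖W x‖ ≤ (1 + θ) * ‖x‖ := by
  calc ‖W x‖ = ‖(W x - x) + x‖ := by rw [sub_add_cancel]
    _ ≤ ‖W x - x‖ + ‖x‖ := norm_add_le _ _
    _ ≤ θ * ‖x‖ + ‖x‖ := by gcongr; exact hW x
    _ = (1 + θ) * ‖x‖ := by ring

/-- `(1 − θ)‖x‖ ≤ ‖Wx‖` when `‖Wx − x‖ ≤ θ‖x‖`. [folklore] [cite: Balaban1985UV3, p.271 (after (62))] -/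
theorem sub_mul_norm_le_norm_apply {W : E →ₗ[ℝ] E} {θ : ℝ} (hW : ∀ x, ‖W x - x‖ ≤ θ * ‖x‖) (x : E) :
    (1 - θ) * ‖x‖ ≤ ‖W x‖ := by
  have h1 : ‖x‖ ≤ ‖W x‖ + ‖W x - x‖ := by
    calc ‖x‖ = ‖W x - (W x - x)‖ := by rw [sub_sub_cancel]
      _ ≤ ‖W x‖ + ‖W x - x‖ := norm_sub_le _ _
  nlinarith [hW x]

/-- `W` is injective when `‖Wx − x‖ ≤ θ‖x‖` with `θ < 1`. [folklore] [cite: Balaban1985UV3, p.271 (after (62))] -/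
theorem injective_of_sub_id {W : E →ₗ[ℝ] E} {θ : ℝ} (hW : ∀ x, ‖W x - x‖ ≤ θ * ‖x‖) (hθ1 : θ < 1) :
    Function.Injective W := by
  rw [injective_iff_map_eq_zero]
  intro x hx
  have h := sub_mul_norm_le_norm_apply hW x
  rw [hx, norm_zero] at h
  have : ‖x‖ ≤ 0 := by nlinarith [norm_nonneg x]
  exact norm_eq_zero.1 (le_antisymm this (norm_nonneg x))

variable [FiniteDimensional ℝ E]

/-- … hence bijective (finite dimension). [folklore] [cite: Balaban1985UV3, p.271 (after (62))] -/
theorem bijective_of_sub_id {W : E →ₗ[ℝ] E} {θ : ℝ} (hW : ∀ x, ‖W x - x‖ ≤ θ * ‖x‖) (hθ1 : θ < 1) :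
    Function.Bijective W :=
  have hinj := injective_of_sub_id hW hθ1
  ⟨hinj, LinearMap.surjective_of_injective hinj⟩

/-- **`|det W| ≤ (1 + θ)^{dim E}`** when `‖Wx − x‖ ≤ θ‖x‖` — for ANY norm on `E` (Haar measure:
`Literature.Analysis.Matrix.abs_det_le_norm_pow`). [folklore] [cite: Balaban1985UV3, p.271 (after (62))] -/
theorem abs_det_le_pow_of_sub_id {W : E →ₗ[ℝ] E} {θ : ℝ} (hθ0 : 0 ≤ θ) (hW : ∀ x, ‖W x - x‖ ≤ θ * ‖x‖) :
    |LinearMap.det W| ≤ (1 + θ) ^ finrank ℝ E := by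
  rcases subsingleton_or_nontrivial E with hE | hE
  · rw [LinearMap.det_eq_one_of_finrank_eq_zero (Module.finrank_zero_of_subsingleton) W, abs_one,
      Module.finrank_zero_of_subsingleton, pow_zero]
  · set A : E →L[ℝ] E := LinearMap.toContinuousLinearMap W with hA
    have hAW : (A : E →ₗ[ℝ] E) = W := rfl
    have hnorm : ‖A‖ ≤ 1 + θ :=
      ContinuousLinearMap.opNorm_le_bound _ (by linarith) fun x => norm_apply_le_of_sub_id hW x
    calc |LinearMap.det W| = |LinearMap.det (A : E →ₗ[ℝ] E)| := by rw [hAW]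
      _ ≤ ‖A‖ ^ finrank ℝ E := Literature.Analysis.Matrix.abs_det_le_norm_pow A
      _ ≤ (1 + θ) ^ finrank ℝ E := pow_le_pow_left₀ (norm_nonneg _) hnorm _

/-- **`(1 − θ)^{dim E} ≤ |det W|`** when `‖Wx − x‖ ≤ θ‖x‖`, `θ < 1` — for ANY norm on `E` (the inverse has norm
`≤ (1 − θ)⁻¹`; `Literature.Analysis.Matrix.abs_det_inv_le_norm_symm_pow`). [folklore] [cite: Balaban1985UV3, p.271 (after (62))] -/
theorem pow_le_abs_det_of_sub_id {W : E →ₗ[ℝ] E} {θ : ℝ} (hW : ∀ x, ‖W x - x‖ ≤ θ * ‖x‖) (hθ1 : θ < 1) :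
    (1 - θ) ^ finrank ℝ E ≤ |LinearMap.det W| := by
  rcases subsingleton_or_nontrivial E with hE | hE
  · rw [LinearMap.det_eq_one_of_finrank_eq_zero (Module.finrank_zero_of_subsingleton) W, abs_one,
      Module.finrank_zero_of_subsingleton, pow_zero]
  · have hbij := bijective_of_sub_id hW hθ1
    set A : E ≃L[ℝ] E := (LinearEquiv.ofBijective W hbij).toContinuousLinearEquiv with hA
    have hAW : ((A : E →L[ℝ] E) : E →ₗ[ℝ] E) = W := rfl
    have h1θ : 0 < 1 - θ := by linarith
    -- the inverse has operator norm `≤ (1 − θ)⁻¹`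
    have hsymm : ‖(A.symm : E →L[ℝ] E)‖ ≤ (1 - θ)⁻¹ := by
      refine ContinuousLinearMap.opNorm_le_bound _ (inv_nonneg.2 h1θ.le) fun y => ?_
      have hy : W ((A.symm : E →L[ℝ] E) y) = y := by
        change (A : E →L[ℝ] E) (A.symm y) = y
        exact A.apply_symm_apply y
      have h : (1 - θ) * ‖(A.symm : E →L[ℝ] E) y‖ ≤ ‖y‖ := by
        have h' := sub_mul_norm_le_norm_apply hW ((A.symm : E →L[ℝ] E) y)
        rwa [hy] at h'
      rw [inv_mul_eq_div, le_div_iff₀ h1θ, mul_comm]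
      exact h
    have hdet := Literature.Analysis.Matrix.abs_det_inv_le_norm_symm_pow A
    rw [hAW] at hdet
    have hdetne : LinearMap.det W ≠ 0 :=
      (LinearMap.isUnit_det _ ((LinearMap.isUnit_iff_ker_eq_bot _).2 (LinearMap.ker_eq_bot.2 hbij.1))).ne_zero
    have hpos : 0 < |LinearMap.det W| := abs_pos.2 hdetne
    have h2 : |(LinearMap.det W)⁻¹| ≤ ((1 - θ)⁻¹) ^ finrank ℝ E :=
      hdet.trans (pow_le_pow_left₀ (norm_nonneg _) hsymm _)
    rw [abs_inv, inv_pow] at h2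
    exact (inv_le_inv₀ hpos (pow_pos h1θ _)).1 h2

/-- `t ↦ det(1 + tT)` is continuous (a polynomial in `t`). [folklore] [cite: Balaban1985UV3, p.271 (after (62))] -/
theorem continuous_det_one_add_smul (T : E →ₗ[ℝ] E) :
    Continuous fun t : ℝ => LinearMap.det ((1 : E →ₗ[ℝ] E) + t • T) := by
  let b := Module.finBasis ℝ E
  have h : (fun t : ℝ => LinearMap.det ((1 : E →ₗ[ℝ] E) + t • T))
      = fun t : ℝ => (LinearMap.toMatrix b b 1 + t • LinearMap.toMatrix b b T).det := by
    funext t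
    rw [← LinearMap.det_toMatrix b, map_add, map_smul]
  rw [h]
  exact (continuous_const.add (continuous_id.smul continuous_const)).matrix_det

/-- **`0 < det W`** when `‖Wx − x‖ ≤ θ‖x‖`, `θ < 1`: along `t ↦ 1 + t(W − 1)`, `t ∈ [0, 1]`, the determinant never
vanishes (each `1 + t(W − 1)` is within `tθ ≤ θ < 1` of the identity, hence injective) and equals `1` at `t = 0`
(intermediate value theorem). [folklore] [cite: Balaban1985UV3, p.271 (after (62))] -/
theorem det_pos_of_sub_id {W : E →ₗ[ℝ] E} {θ : ℝ} (hW : ∀ x, ‖W x - x‖ ≤ θ * ‖x‖) (hθ1 : θ < 1) :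
    0 < LinearMap.det W := by
  set f : ℝ → ℝ := fun t => LinearMap.det ((1 : E →ₗ[ℝ] E) + t • (W - 1)) with hf
  have hcont : Continuous f := continuous_det_one_add_smul (W - 1)
  have hne : ∀ t ∈ Set.Icc (0 : ℝ) 1, f t ≠ 0 := by
    intro t ht
    have hWt : ∀ x, ‖((1 : E →ₗ[ℝ] E) + t • (W - 1)) x - x‖ ≤ θ * ‖x‖ := fun x => by
      have h1 : ((1 : E →ₗ[ℝ] E) + t • (W - 1)) x - x = t • (W x - x) := by
        simp only [LinearMap.add_apply, Module.End.one_apply, LinearMap.smul_apply, LinearMap.sub_apply]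
        rw [smul_sub]
        abel
      rw [h1, norm_smul, Real.norm_of_nonneg ht.1]
      calc t * ‖W x - x‖ ≤ 1 * (θ * ‖x‖) :=
            mul_le_mul ht.2 (hW x) (norm_nonneg _) zero_le_one
        _ = θ * ‖x‖ := one_mul _
    have hinj := injective_of_sub_id hWt hθ1
    exact (LinearMap.isUnit_det _
      ((LinearMap.isUnit_iff_ker_eq_bot _).2 (LinearMap.ker_eq_bot.2 hinj))).ne_zero
  have hf0 : f 0 = 1 := by simp [hf]
  have hf1 : f 1 = LinearMap.det W := by
    simp only [hf, one_smul, add_sub_cancel]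
  rw [← hf1]
  rcases lt_or_gt_of_ne (hne 1 ⟨zero_le_one, le_rfl⟩) with hneg | hpos
  · exfalso
    obtain ⟨t, ht, hft⟩ :=
      intermediate_value_Icc' (zero_le_one : (0 : ℝ) ≤ 1) hcont.continuousOn
        ⟨hneg.le, by rw [hf0]; exact zero_le_one⟩
    exact hne t ht hft
  · exact hpos

/-- **`(1 − θ)^{dim E} ≤ det W ≤ (1 + θ)^{dim E}`** and `0 < det W` when `‖Wx − x‖ ≤ θ‖x‖`, `0 ≤ θ < 1`, for ANY
norm. [folklore] [cite: Balaban1985UV3, p.271 (after (62))] -/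
theorem det_bounds_of_sub_id {W : E →ₗ[ℝ] E} {θ : ℝ} (hθ0 : 0 ≤ θ) (hW : ∀ x, ‖W x - x‖ ≤ θ * ‖x‖)
    (hθ1 : θ < 1) :
    (1 - θ) ^ finrank ℝ E ≤ LinearMap.det W ∧ LinearMap.det W ≤ (1 + θ) ^ finrank ℝ E := by
  have hpos := det_pos_of_sub_id hW hθ1
  have h1 := pow_le_abs_det_of_sub_id hW hθ1
  have h2 := abs_det_le_pow_of_sub_id hθ0 hW
  rw [abs_of_pos hpos] at h1 h2
  exact ⟨h1, h2⟩

/-- **`|log det W| ≤ dim E · log(1/(1 − θ))`** (`= −dim E·log(1 − θ)`) when `‖Wx − x‖ ≤ θ‖x‖`, `0 ≤ θ < 1`, for ANY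
norm: `dim E·log(1 − θ) ≤ log det W ≤ dim E·log(1 + θ) ≤ −dim E·log(1 − θ)`. [folklore] [cite: Balaban1985UV3, p.271 (after (62))] -/
theorem abs_log_det_le_of_sub_id {W : E →ₗ[ℝ] E} {θ : ℝ} (hθ0 : 0 ≤ θ) (hW : ∀ x, ‖W x - x‖ ≤ θ * ‖x‖)
    (hθ1 : θ < 1) :
    |Real.log (LinearMap.det W)| ≤ finrank ℝ E * (-Real.log (1 - θ)) := by
  obtain ⟨hlo, hhi⟩ := det_bounds_of_sub_id hθ0 hW hθ1
  have hpos := det_pos_of_sub_id hW hθ1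
  have h1θ : 0 < 1 - θ := by linarith
  have hlog_lo : (finrank ℝ E : ℝ) * Real.log (1 - θ) ≤ Real.log (LinearMap.det W) := by
    rw [← Real.log_pow]
    exact Real.log_le_log (pow_pos h1θ _) hlo
  have hlog_hi : Real.log (LinearMap.det W) ≤ (finrank ℝ E : ℝ) * Real.log (1 + θ) := by
    rw [← Real.log_pow]
    exact Real.log_le_log hpos hhi
  -- `log(1 + θ) ≤ −log(1 − θ)` since `(1 + θ)(1 − θ) ≤ 1`
  have hlt : Real.log (1 + θ) ≤ -Real.log (1 - θ) := by
    rw [← Real.log_inv, inv_eq_one_div]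
    refine Real.log_le_log (by linarith) ?_
    rw [le_div_iff₀ h1θ]
    nlinarith
  have hn : (0 : ℝ) ≤ finrank ℝ E := Nat.cast_nonneg _
  rw [abs_le]
  constructor
  · calc -((finrank ℝ E : ℝ) * -Real.log (1 - θ)) = (finrank ℝ E : ℝ) * Real.log (1 - θ) := by ring
      _ ≤ Real.log (LinearMap.det W) := hlog_lo
  · exact hlog_hi.trans (mul_le_mul_of_nonneg_left hlt hn)

/-- the elementary `−log(1 − θ) ≤ θ/(1 − θ)` for `0 ≤ θ < 1` (`log x ≤ x − 1` at `x = (1 − θ)⁻¹`). [folklore] [cite: Balaban1985UV3, p.271 (after (62))] -/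
theorem neg_log_one_sub_le_div {θ : ℝ} (hθ1 : θ < 1) : -Real.log (1 - θ) ≤ θ / (1 - θ) := by
  have h1θ : 0 < 1 - θ := by linarith
  rw [← Real.log_inv]
  have h := Real.log_le_sub_one_of_pos (inv_pos.2 h1θ)
  have h2 : (1 - θ)⁻¹ - 1 = θ / (1 - θ) := by
    field_simp
    ring
  linarith [h, h2]

/-- **`|log det W| ≤ dim E · θ/(1 − θ)`** when `‖Wx − x‖ ≤ θ‖x‖`, `0 ≤ θ < 1`, for ANY norm — the first-order size of the
logarithm of the determinant of a perturbation of the identity. [folklore] [cite: Balaban1985UV3, p.271 (after (62))] -/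
theorem abs_log_det_le_div_of_sub_id {W : E →ₗ[ℝ] E} {θ : ℝ} (hθ0 : 0 ≤ θ) (hW : ∀ x, ‖W x - x‖ ≤ θ * ‖x‖)
    (hθ1 : θ < 1) :
    |Real.log (LinearMap.det W)| ≤ finrank ℝ E * (θ / (1 - θ)) :=
  (abs_log_det_le_of_sub_id hθ0 hW hθ1).trans
    (mul_le_mul_of_nonneg_left (neg_log_one_sub_le_div hθ1) (Nat.cast_nonneg _))

end Folklore

/-! ## §2 The relative coefficient `W(V₀, b₀(c)) := (L·S₀)⁻¹ ∘ S(V₀, b₀(c))` on `𝔤` -/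

section Relative

open B7Prop1Explicit B7Prop3GeneralRotated B7Eq125RightInverse
open B7Eq78Linearization (conjR conjR_apply conjR_smul_real conjR_sub)
open B8Ineq132 (conjR_conjR one_conjR norm_conjR)
open B7Prop2Explicit (hol_mem_of)
open B10Eq61SpineCoefficient (fullCoeff fullCoeffOn fullCoeffOn_apply mainCoeff mainCoeffOn mainCoeffOn_apply conjROn
  conjROn_apply abs_det_conjROn norm_mainCoeff norm_fullCoeff_sub_smul_mainCoeff_le mainCoeff_apply fullCoeff_one)

-- `Site` alone would resolve to the torus sites of `Setup.lean`; re-export the `ℤ^d` sites of `B7Prop1Explicit`.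
export B7Prop1Explicit (Site)

variable {d : ℕ}
variable {𝔸 : Type*} [NormedRing 𝔸] [NormedAlgebra ℂ 𝔸] [NormOneClass 𝔸] [CompleteSpace 𝔸]
variable (L : ℕ)

/-- **THE RELATIVE COEFFICIENT `W(V₀, b₀(c)) := (L·S₀(V₀, b₀(c)))⁻¹ ∘ S(V₀, b₀(c))` ON `𝔤`** — the full `b₀(c)`-coefficient
measured against its main term: `(L·S₀)⁻¹ = L⁻¹L^{d}·R(u)⁻¹`, `u = V₀([c₋, b₀(c)₋])` the spine transporter, so
`W = L⁻¹L^{d}·R(u⁻¹)|_𝔤 ∘ S|_𝔤`; by (124)–(126) of [4] `W = 1 + O(L²α₀)` (§3). [cite: Balaban1985UV3, p.271 (after (62)); Balaban1985Averaging, (124)–(126) p.36] -/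
def relCoeffOn (𝔤 : Submodule ℝ 𝔸) {H : Subgroup 𝔸ˣ} (hst : ∀ u : 𝔸ˣ, u ∈ H → ∀ X ∈ 𝔤, conjR u X ∈ 𝔤)
    {V₀ : Site d → Fin d → 𝔸ˣ} (hV₀ : ∀ x κ, V₀ x κ ∈ H) (y : Site d) (κ : Fin d)
    (hW1 : ∀ r : Fin d → Fin L, ‖((Wcx L V₀ (corner L y) κ (boxVec L r) : 𝔸ˣ) : 𝔸) - 1‖ < 1)
    (h𝔤 : ∀ X ∈ 𝔤, fullCoeff L V₀ y κ X ∈ 𝔤) : 𝔤 →ₗ[ℝ] 𝔤 :=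
  ((L : ℝ)⁻¹ * (L : ℝ) ^ d) •
    (conjROn 𝔤 (hol V₀ (corner L y) (seg κ (((L - 1 : ℕ) : ℤ))))⁻¹ (hst _ (H.inv_mem (hol_mem_of hV₀ _ _)))
      ∘ₗ fullCoeffOn L 𝔤 V₀ y κ hW1 h𝔤)

variable {L}

/-- (value of the relative coefficient) [cite: Balaban1985Averaging, (124)–(126) p.36] -/
theorem relCoeffOn_apply (𝔤 : Submodule ℝ 𝔸) {H : Subgroup 𝔸ˣ} (hst : ∀ u : 𝔸ˣ, u ∈ H → ∀ X ∈ 𝔤, conjR u X ∈ 𝔤)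
    {V₀ : Site d → Fin d → 𝔸ˣ} (hV₀ : ∀ x κ, V₀ x κ ∈ H) (y : Site d) (κ : Fin d)
    (hW1 : ∀ r : Fin d → Fin L, ‖((Wcx L V₀ (corner L y) κ (boxVec L r) : 𝔸ˣ) : 𝔸) - 1‖ < 1)
    (h𝔤 : ∀ X ∈ 𝔤, fullCoeff L V₀ y κ X ∈ 𝔤) (X : 𝔤) :
    ((relCoeffOn L 𝔤 hst hV₀ y κ hW1 h𝔤 X : 𝔤) : 𝔸)
      = ((L : ℝ)⁻¹ * (L : ℝ) ^ d) •
          conjR (hol V₀ (corner L y) (seg κ (((L - 1 : ℕ) : ℤ))))⁻¹ (fullCoeff L V₀ y κ X) := by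
  rw [relCoeffOn, LinearMap.smul_apply, Submodule.coe_smul, LinearMap.coe_comp, Function.comp_apply,
    conjROn_apply, fullCoeffOn_apply]

/-- **`S(V₀, b₀(c)) = L·S₀(V₀, b₀(c)) ∘ W(V₀, b₀(c))` EXACTLY** on `𝔤` — the factorisation of the full coefficient into
its main term and the relative coefficient. [cite: Balaban1985UV3, p.271 (after (62)); Balaban1985Averaging, (124)–(125) p.36] -/
theorem smul_mainCoeffOn_comp_relCoeffOn (hL : 1 ≤ L) (𝔤 : Submodule ℝ 𝔸) {H : Subgroup 𝔸ˣ}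
    (hst : ∀ u : 𝔸ˣ, u ∈ H → ∀ X ∈ 𝔤, conjR u X ∈ 𝔤) {V₀ : Site d → Fin d → 𝔸ˣ} (hV₀ : ∀ x κ, V₀ x κ ∈ H)
    (y : Site d) (κ : Fin d)
    (hW1 : ∀ r : Fin d → Fin L, ‖((Wcx L V₀ (corner L y) κ (boxVec L r) : 𝔸ˣ) : 𝔸) - 1‖ < 1)
    (h𝔤 : ∀ X ∈ 𝔤, fullCoeff L V₀ y κ X ∈ 𝔤) :
    ((L : ℝ) • mainCoeffOn L 𝔤 hst hV₀ y κ) ∘ₗ relCoeffOn L 𝔤 hst hV₀ y κ hW1 h𝔤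
      = fullCoeffOn L 𝔤 V₀ y κ hW1 h𝔤 := by
  have hLne : (L : ℝ) ≠ 0 := by exact_mod_cast (Nat.one_le_iff_ne_zero.1 hL)
  ext X
  rw [LinearMap.coe_comp, Function.comp_apply, LinearMap.smul_apply, Submodule.coe_smul, mainCoeffOn_apply,
    mainCoeff_apply, relCoeffOn_apply, conjR_smul_real, B7Eq125RightInverse.conjR_conjR_inv, smul_smul, smul_smul,
    fullCoeffOn_apply]
  have hc : (L : ℝ) * (((L : ℝ) ^ d)⁻¹) * ((L : ℝ)⁻¹ * (L : ℝ) ^ d) = 1 := by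
    field_simp
  rw [hc, one_smul]

/-- **`det S(V₀, b₀(c))|_𝔤 = L^{dim 𝔤}·L^{−d·dim 𝔤}·det R(u)|_𝔤 · det W(V₀, b₀(c))`**, `u = V₀([c₋, b₀(c)₋])`
(`det_mainCoeffOn_eq` of `B10Eq61DetPositive` for the main-term factor). [cite: Balaban1985UV3, p.271 (after (62)); Balaban1985Averaging, (124)–(125) p.36] -/
theorem det_fullCoeffOn_eq_mul_det_relCoeffOn (hL : 1 ≤ L) (𝔤 : Submodule ℝ 𝔸) [FiniteDimensional ℝ 𝔤]
    {H : Subgroup 𝔸ˣ} (hst : ∀ u : 𝔸ˣ, u ∈ H → ∀ X ∈ 𝔤, conjR u X ∈ 𝔤) {V₀ : Site d → Fin d → 𝔸ˣ}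
    (hV₀ : ∀ x κ, V₀ x κ ∈ H) (y : Site d) (κ : Fin d)
    (hW1 : ∀ r : Fin d → Fin L, ‖((Wcx L V₀ (corner L y) κ (boxVec L r) : 𝔸ˣ) : 𝔸) - 1‖ < 1)
    (h𝔤 : ∀ X ∈ 𝔤, fullCoeff L V₀ y κ X ∈ 𝔤) :
    LinearMap.det (fullCoeffOn L 𝔤 V₀ y κ hW1 h𝔤)
      = (L : ℝ) ^ Module.finrank ℝ 𝔤 * (((L : ℝ) ^ d)⁻¹) ^ Module.finrank ℝ 𝔤
        * LinearMap.det (conjROn 𝔤 (hol V₀ (corner L y) (seg κ (((L - 1 : ℕ) : ℤ))))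
            (hst _ (hol_mem_of hV₀ _ _)))
        * LinearMap.det (relCoeffOn L 𝔤 hst hV₀ y κ hW1 h𝔤) := by
  rw [← smul_mainCoeffOn_comp_relCoeffOn hL 𝔤 hst hV₀ y κ hW1 h𝔤, LinearMap.det_comp, LinearMap.det_smul,
    B10Eq61DetPositive.det_mainCoeffOn_eq]
  ring

/-- **`‖W(V₀, b₀(c))X − X‖ ≤ 50(d+1)·ε·L^{d}·‖X‖`** at a background with values in `H ≤ U1` whose block loops at `c`
satisfy `‖W_x(V₀) − 1‖ ≤ ε ≤ 1/8`: (126) of [4] (`norm_fullCoeff_sub_smul_mainCoeff_le`: `‖SX − L·S₀X‖ ≤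
50(d+1)εL‖X‖`) transported by the isometry `L⁻¹L^{d}·R(u⁻¹)` — the relative coefficient is the identity up to
`θ := 50(d+1)εL^{d}` («the operators occurring in these terms can be estimated by O(L²α₀)»).
[cite: Balaban1985Averaging, (124)–(126) p.36; Balaban1985UV3, p.271 (after (62))] -/
theorem norm_relCoeffOn_sub_le (hL : 1 ≤ L) (𝔤 : Submodule ℝ 𝔸) {H : Subgroup 𝔸ˣ} (hH : H ≤ U1 𝔸)
    (hst : ∀ u : 𝔸ˣ, u ∈ H → ∀ X ∈ 𝔤, conjR u X ∈ 𝔤) {V₀ : Site d → Fin d → 𝔸ˣ} (hV₀ : ∀ x κ, V₀ x κ ∈ H)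
    (y : Site d) (κ : Fin d) {ε : ℝ} (hε0 : 0 ≤ ε) (hε : ε ≤ 1 / 8)
    (hW : ∀ r : Fin d → Fin L, ‖((Wcx L V₀ (corner L y) κ (boxVec L r) : 𝔸ˣ) : 𝔸) - 1‖ ≤ ε)
    (hW1 : ∀ r : Fin d → Fin L, ‖((Wcx L V₀ (corner L y) κ (boxVec L r) : 𝔸ˣ) : 𝔸) - 1‖ < 1)
    (h𝔤 : ∀ X ∈ 𝔤, fullCoeff L V₀ y κ X ∈ 𝔤) (X : 𝔤) :
    ‖relCoeffOn L 𝔤 hst hV₀ y κ hW1 h𝔤 X - X‖ ≤ 50 * (d + 1) * ε * (L : ℝ) ^ d * ‖X‖ := by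
  have hU : ∀ x κ, V₀ x κ ∈ U1 𝔸 := fun x κ => hH (hV₀ x κ)
  have hLpos : (0 : ℝ) < L := by exact_mod_cast hL
  have hLne : (L : ℝ) ≠ 0 := hLpos.ne'
  have hu1 : (hol V₀ (corner L y) (seg κ (((L - 1 : ℕ) : ℤ))))⁻¹ ∈ U1 𝔸 :=
    (U1 𝔸).inv_mem (hH (hol_mem_of hV₀ _ _))
  -- the value of `WX − X` in `𝔸`
  have hval : ((relCoeffOn L 𝔤 hst hV₀ y κ hW1 h𝔤 X - X : 𝔤) : 𝔸)
      = ((L : ℝ)⁻¹ * (L : ℝ) ^ d) • conjR (hol V₀ (corner L y) (seg κ (((L - 1 : ℕ) : ℤ))))⁻¹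
          (fullCoeff L V₀ y κ X - (L : ℝ) • mainCoeff L V₀ y κ X) := by
    rw [Submodule.coe_sub, relCoeffOn_apply, conjR_sub, smul_sub, mainCoeff_apply, conjR_smul_real,
      conjR_smul_real, B9Eq332AvgCovariance.conjR_inv_conjR, smul_smul, smul_smul]
    have hc : (L : ℝ)⁻¹ * (L : ℝ) ^ d * (L : ℝ) * (((L : ℝ) ^ d)⁻¹) = 1 := by field_simp
    rw [hc, one_smul]
  have hnorm : ‖relCoeffOn L 𝔤 hst hV₀ y κ hW1 h𝔤 X - X‖
      = ((L : ℝ)⁻¹ * (L : ℝ) ^ d) * ‖fullCoeff L V₀ y κ X - (L : ℝ) • mainCoeff L V₀ y κ X‖ := by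
    change ‖((relCoeffOn L 𝔤 hst hV₀ y κ hW1 h𝔤 X - X : 𝔤) : 𝔸)‖ = _
    rw [hval, norm_smul, norm_conjR hu1, Real.norm_of_nonneg (by positivity)]
  rw [hnorm]
  have h126 := norm_fullCoeff_sub_smul_mainCoeff_le hL hU y κ hε0 hε hW (X : 𝔸)
  have hX : ‖(X : 𝔸)‖ = ‖X‖ := rfl
  rw [hX] at h126
  calc ((L : ℝ)⁻¹ * (L : ℝ) ^ d) * ‖fullCoeff L V₀ y κ X - (L : ℝ) • mainCoeff L V₀ y κ X‖
      ≤ ((L : ℝ)⁻¹ * (L : ℝ) ^ d) * (50 * (d + 1) * ε * L * ‖X‖) :=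
        mul_le_mul_of_nonneg_left h126 (by positivity)
    _ = 50 * (d + 1) * ε * (L : ℝ) ^ d * ‖X‖ := by field_simp

end Relative

/-! ## §3 The size window `θ := 50(d+1)εL^{d} < 1` and the determinant of `W(V₀, b₀(c))` on `𝔤` -/

section DetBounds

open B7Prop1Explicit B7Prop3GeneralRotated B7Eq125RightInverse
open B7Eq78Linearization (conjR)
open B7Prop2Explicit (hol_mem_of)
open B10Eq61SpineCoefficient (fullCoeff fullCoeffOn mainCoeffOn conjROn abs_det_conjROn)

variable {d : ℕ}
variable {𝔸 : Type*} [NormedRing 𝔸] [NormedAlgebra ℂ 𝔸] [NormOneClass 𝔸] [CompleteSpace 𝔸]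
variable {L : ℕ}

omit [NormedAlgebra ℂ 𝔸] [NormOneClass 𝔸] [CompleteSpace 𝔸] in
/-- the §9d window `50(d+1)ε < L^{−d}` of `B10Eq61SpineCoefficient` IS `θ = 50(d+1)εL^{d} < 1`. [cite: Balaban1985Averaging, Proposition 3 p.36 («c₃ depends on d and L»), (126) p.36] -/
theorem theta_lt_one (hL : 1 ≤ L) {ε : ℝ} (hsmall : 50 * (d + 1) * ε < (((L : ℝ) ^ d)⁻¹)) :
    50 * (d + 1) * ε * (L : ℝ) ^ d < 1 := by
  have hLd : (0 : ℝ) < (L : ℝ) ^ d := by positivity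
  have h := mul_lt_mul_of_pos_right hsmall hLd
  rwa [inv_mul_cancel₀ hLd.ne'] at h

omit [NormedAlgebra ℂ 𝔸] [NormOneClass 𝔸] [CompleteSpace 𝔸] in
/-- … and conversely. [cite: Balaban1985Averaging, Proposition 3 p.36, (126) p.36] -/
theorem theta_lt_one_iff (hL : 1 ≤ L) {ε : ℝ} :
    50 * (d + 1) * ε * (L : ℝ) ^ d < 1 ↔ 50 * (d + 1) * ε < (((L : ℝ) ^ d)⁻¹) := by
  have hLd : (0 : ℝ) < (L : ℝ) ^ d := by positivity
  rw [← lt_div_iff₀ hLd, one_div]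

/-- **`0 < det W(V₀, b₀(c))`** at a regular background (`H ≤ U1`-valued, block loops at `c` within `ε ≦ 1/8` of `1`,
`50(d+1)ε < L^{−d}`): §1 with `θ = 50(d+1)εL^{d} < 1`. [cite: Balaban1985UV3, p.271 (after (62)); Balaban1985Averaging, (124)–(126) p.36] -/
theorem det_relCoeffOn_pos (hL : 1 ≤ L) (𝔤 : Submodule ℝ 𝔸) [FiniteDimensional ℝ 𝔤] {H : Subgroup 𝔸ˣ}
    (hH : H ≤ U1 𝔸) (hst : ∀ u : 𝔸ˣ, u ∈ H → ∀ X ∈ 𝔤, conjR u X ∈ 𝔤) {V₀ : Site d → Fin d → 𝔸ˣ}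
    (hV₀ : ∀ x κ, V₀ x κ ∈ H) (y : Site d) (κ : Fin d) {ε : ℝ} (hε0 : 0 ≤ ε) (hε : ε ≤ 1 / 8)
    (hW : ∀ r : Fin d → Fin L, ‖((Wcx L V₀ (corner L y) κ (boxVec L r) : 𝔸ˣ) : 𝔸) - 1‖ ≤ ε)
    (hsmall : 50 * (d + 1) * ε < (((L : ℝ) ^ d)⁻¹))
    (hW1 : ∀ r : Fin d → Fin L, ‖((Wcx L V₀ (corner L y) κ (boxVec L r) : 𝔸ˣ) : 𝔸) - 1‖ < 1)
    (h𝔤 : ∀ X ∈ 𝔤, fullCoeff L V₀ y κ X ∈ 𝔤) :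
    0 < LinearMap.det (relCoeffOn L 𝔤 hst hV₀ y κ hW1 h𝔤) :=
  det_pos_of_sub_id (norm_relCoeffOn_sub_le hL 𝔤 hH hst hV₀ y κ hε0 hε hW hW1 h𝔤) (theta_lt_one hL hsmall)

/-- **`(1 − θ)^{dim 𝔤} ≤ det W(V₀, b₀(c)) ≤ (1 + θ)^{dim 𝔤}`**, `θ = 50(d+1)εL^{d}`, at a regular background — for the
algebra norm on `𝔤 ⊂ 𝔸` (§1, any norm). [cite: Balaban1985UV3, p.271 (after (62)); Balaban1985Averaging, (124)–(126) p.36] -/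
theorem det_relCoeffOn_bounds (hL : 1 ≤ L) (𝔤 : Submodule ℝ 𝔸) [FiniteDimensional ℝ 𝔤] {H : Subgroup 𝔸ˣ}
    (hH : H ≤ U1 𝔸) (hst : ∀ u : 𝔸ˣ, u ∈ H → ∀ X ∈ 𝔤, conjR u X ∈ 𝔤) {V₀ : Site d → Fin d → 𝔸ˣ}
    (hV₀ : ∀ x κ, V₀ x κ ∈ H) (y : Site d) (κ : Fin d) {ε : ℝ} (hε0 : 0 ≤ ε) (hε : ε ≤ 1 / 8)
    (hW : ∀ r : Fin d → Fin L, ‖((Wcx L V₀ (corner L y) κ (boxVec L r) : 𝔸ˣ) : 𝔸) - 1‖ ≤ ε)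
    (hsmall : 50 * (d + 1) * ε < (((L : ℝ) ^ d)⁻¹))
    (hW1 : ∀ r : Fin d → Fin L, ‖((Wcx L V₀ (corner L y) κ (boxVec L r) : 𝔸ˣ) : 𝔸) - 1‖ < 1)
    (h𝔤 : ∀ X ∈ 𝔤, fullCoeff L V₀ y κ X ∈ 𝔤) :
    (1 - 50 * (d + 1) * ε * (L : ℝ) ^ d) ^ Module.finrank ℝ 𝔤 ≤ LinearMap.det (relCoeffOn L 𝔤 hst hV₀ y κ hW1 h𝔤)
      ∧ LinearMap.det (relCoeffOn L 𝔤 hst hV₀ y κ hW1 h𝔤)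
          ≤ (1 + 50 * (d + 1) * ε * (L : ℝ) ^ d) ^ Module.finrank ℝ 𝔤 :=
  det_bounds_of_sub_id (by positivity) (norm_relCoeffOn_sub_le hL 𝔤 hH hst hV₀ y κ hε0 hε hW hW1 h𝔤)
    (theta_lt_one hL hsmall)

/-- **`|log det W(V₀, b₀(c))| ≤ dim 𝔤 · log(1/(1 − θ))`**, `θ = 50(d+1)εL^{d}`, at a regular background.
[cite: Balaban1985UV3, p.271 (after (62)); Balaban1985Averaging, (124)–(126) p.36] -/
theorem abs_log_det_relCoeffOn_le (hL : 1 ≤ L) (𝔤 : Submodule ℝ 𝔸) [FiniteDimensional ℝ 𝔤] {H : Subgroup 𝔸ˣ}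
    (hH : H ≤ U1 𝔸) (hst : ∀ u : 𝔸ˣ, u ∈ H → ∀ X ∈ 𝔤, conjR u X ∈ 𝔤) {V₀ : Site d → Fin d → 𝔸ˣ}
    (hV₀ : ∀ x κ, V₀ x κ ∈ H) (y : Site d) (κ : Fin d) {ε : ℝ} (hε0 : 0 ≤ ε) (hε : ε ≤ 1 / 8)
    (hW : ∀ r : Fin d → Fin L, ‖((Wcx L V₀ (corner L y) κ (boxVec L r) : 𝔸ˣ) : 𝔸) - 1‖ ≤ ε)
    (hsmall : 50 * (d + 1) * ε < (((L : ℝ) ^ d)⁻¹))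
    (hW1 : ∀ r : Fin d → Fin L, ‖((Wcx L V₀ (corner L y) κ (boxVec L r) : 𝔸ˣ) : 𝔸) - 1‖ < 1)
    (h𝔤 : ∀ X ∈ 𝔤, fullCoeff L V₀ y κ X ∈ 𝔤) :
    |Real.log (LinearMap.det (relCoeffOn L 𝔤 hst hV₀ y κ hW1 h𝔤))|
      ≤ Module.finrank ℝ 𝔤 * (-Real.log (1 - 50 * (d + 1) * ε * (L : ℝ) ^ d)) :=
  abs_log_det_le_of_sub_id (by positivity) (norm_relCoeffOn_sub_le hL 𝔤 hH hst hV₀ y κ hε0 hε hW hW1 h𝔤)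
    (theta_lt_one hL hsmall)

/-- **`|log det W(V₀, b₀(c))| ≤ dim 𝔤 · θ/(1 − θ)`**, `θ = 50(d+1)εL^{d}` — first order in the regularity `ε`.
[cite: Balaban1985UV3, p.271 (after (62)); Balaban1985Averaging, (124)–(126) p.36] -/
theorem abs_log_det_relCoeffOn_le_div (hL : 1 ≤ L) (𝔤 : Submodule ℝ 𝔸) [FiniteDimensional ℝ 𝔤]
    {H : Subgroup 𝔸ˣ} (hH : H ≤ U1 𝔸) (hst : ∀ u : 𝔸ˣ, u ∈ H → ∀ X ∈ 𝔤, conjR u X ∈ 𝔤)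
    {V₀ : Site d → Fin d → 𝔸ˣ} (hV₀ : ∀ x κ, V₀ x κ ∈ H) (y : Site d) (κ : Fin d) {ε : ℝ} (hε0 : 0 ≤ ε)
    (hε : ε ≤ 1 / 8) (hW : ∀ r : Fin d → Fin L, ‖((Wcx L V₀ (corner L y) κ (boxVec L r) : 𝔸ˣ) : 𝔸) - 1‖ ≤ ε)
    (hsmall : 50 * (d + 1) * ε < (((L : ℝ) ^ d)⁻¹))
    (hW1 : ∀ r : Fin d → Fin L, ‖((Wcx L V₀ (corner L y) κ (boxVec L r) : 𝔸ˣ) : 𝔸) - 1‖ < 1)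
    (h𝔤 : ∀ X ∈ 𝔤, fullCoeff L V₀ y κ X ∈ 𝔤) :
    |Real.log (LinearMap.det (relCoeffOn L 𝔤 hst hV₀ y κ hW1 h𝔤))|
      ≤ Module.finrank ℝ 𝔤 * (50 * (d + 1) * ε * (L : ℝ) ^ d / (1 - 50 * (d + 1) * ε * (L : ℝ) ^ d)) :=
  abs_log_det_le_div_of_sub_id (by positivity) (norm_relCoeffOn_sub_le hL 𝔤 hH hst hV₀ y κ hε0 hε hW hW1 h𝔤)
    (theta_lt_one hL hsmall)

end DetBounds

/-! ## §4 The local term: `−log|det S(V₀, b₀(c))|_𝔤 = (d − 1)·dim 𝔤·log L − log det W(V₀, b₀(c))` and its size -/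

section LocalTerm

open B7Prop1Explicit B7Prop3GeneralRotated B7Eq125RightInverse
open B7Eq78Linearization (conjR)
open B7Prop2Explicit (hol_mem_of)
open B10Eq61SpineCoefficient (fullCoeff fullCoeffOn mainCoeffOn conjROn abs_det_conjROn)

variable {d : ℕ}
variable {𝔸 : Type*} [NormedRing 𝔸] [NormedAlgebra ℂ 𝔸] [NormOneClass 𝔸] [CompleteSpace 𝔸]
variable {L : ℕ}

/-- **`|det S(V₀, b₀(c))|_𝔤 = L^{dim 𝔤}·L^{−d·dim 𝔤}·det W(V₀, b₀(c))`** for EVERY `H ≤ U1`-valued regular background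
(`|det R(u)|_𝔤| = 1`, `abs_det_conjROn`; `det W > 0`, §3). [cite: Balaban1985UV3, p.271 (after (62)); Balaban1985Averaging, (124)–(126) p.36] -/
theorem abs_det_fullCoeffOn_eq (hL : 1 ≤ L) (𝔤 : Submodule ℝ 𝔸) [FiniteDimensional ℝ 𝔤] {H : Subgroup 𝔸ˣ}
    (hH : H ≤ U1 𝔸) (hst : ∀ u : 𝔸ˣ, u ∈ H → ∀ X ∈ 𝔤, conjR u X ∈ 𝔤) {V₀ : Site d → Fin d → 𝔸ˣ}
    (hV₀ : ∀ x κ, V₀ x κ ∈ H) (y : Site d) (κ : Fin d) {ε : ℝ} (hε0 : 0 ≤ ε) (hε : ε ≤ 1 / 8)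
    (hW : ∀ r : Fin d → Fin L, ‖((Wcx L V₀ (corner L y) κ (boxVec L r) : 𝔸ˣ) : 𝔸) - 1‖ ≤ ε)
    (hsmall : 50 * (d + 1) * ε < (((L : ℝ) ^ d)⁻¹))
    (hW1 : ∀ r : Fin d → Fin L, ‖((Wcx L V₀ (corner L y) κ (boxVec L r) : 𝔸ˣ) : 𝔸) - 1‖ < 1)
    (h𝔤 : ∀ X ∈ 𝔤, fullCoeff L V₀ y κ X ∈ 𝔤) :
    |LinearMap.det (fullCoeffOn L 𝔤 V₀ y κ hW1 h𝔤)|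
      = (L : ℝ) ^ Module.finrank ℝ 𝔤 * (((L : ℝ) ^ d)⁻¹) ^ Module.finrank ℝ 𝔤
          * LinearMap.det (relCoeffOn L 𝔤 hst hV₀ y κ hW1 h𝔤) := by
  have hLpos : (0 : ℝ) < L := by exact_mod_cast hL
  rw [det_fullCoeffOn_eq_mul_det_relCoeffOn hL 𝔤 hst hV₀ y κ hW1 h𝔤, abs_mul, abs_mul, abs_mul,
    abs_det_conjROn 𝔤 (hH (hol_mem_of hV₀ _ _)), mul_one,
    abs_of_pos (det_relCoeffOn_pos hL 𝔤 hH hst hV₀ y κ hε0 hε hW hsmall hW1 h𝔤),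
    abs_of_pos (pow_pos hLpos _), abs_of_pos (pow_pos (inv_pos.2 (pow_pos hLpos _)) _)]

/-- **`−log|det S(V₀, b₀(c))|_𝔤 = (d − 1)·dim 𝔤·log L − log det W(V₀, b₀(c))`** for EVERY `H ≤ U1`-valued regular
background: the local term of p. 271 (in the `|det|` reading of `B10Eq61EliminationTerms`; = `−log det S` under [4]
p. 20's `G = e^𝔤`, below) is its FLAT VALUE `(d − 1)·dim 𝔤·log L` (§5) minus the logarithm of the relative coefficient.
[cite: Balaban1985UV3, p.271 (after (62)); Balaban1985Averaging, (124)–(126) p.36] -/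
theorem neg_log_abs_det_fullCoeffOn_eq (hL : 1 ≤ L) (𝔤 : Submodule ℝ 𝔸) [FiniteDimensional ℝ 𝔤]
    {H : Subgroup 𝔸ˣ} (hH : H ≤ U1 𝔸) (hst : ∀ u : 𝔸ˣ, u ∈ H → ∀ X ∈ 𝔤, conjR u X ∈ 𝔤)
    {V₀ : Site d → Fin d → 𝔸ˣ} (hV₀ : ∀ x κ, V₀ x κ ∈ H) (y : Site d) (κ : Fin d) {ε : ℝ} (hε0 : 0 ≤ ε)
    (hε : ε ≤ 1 / 8) (hW : ∀ r : Fin d → Fin L, ‖((Wcx L V₀ (corner L y) κ (boxVec L r) : 𝔸ˣ) : 𝔸) - 1‖ ≤ ε)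
    (hsmall : 50 * (d + 1) * ε < (((L : ℝ) ^ d)⁻¹))
    (hW1 : ∀ r : Fin d → Fin L, ‖((Wcx L V₀ (corner L y) κ (boxVec L r) : 𝔸ˣ) : 𝔸) - 1‖ < 1)
    (h𝔤 : ∀ X ∈ 𝔤, fullCoeff L V₀ y κ X ∈ 𝔤) :
    -Real.log |LinearMap.det (fullCoeffOn L 𝔤 V₀ y κ hW1 h𝔤)|
      = ((d : ℝ) - 1) * Module.finrank ℝ 𝔤 * Real.log L
          - Real.log (LinearMap.det (relCoeffOn L 𝔤 hst hV₀ y κ hW1 h𝔤)) := by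
  have hLpos : (0 : ℝ) < L := by exact_mod_cast hL
  have hdetpos := det_relCoeffOn_pos hL 𝔤 hH hst hV₀ y κ hε0 hε hW hsmall hW1 h𝔤
  have h1 : (L : ℝ) ^ Module.finrank ℝ 𝔤 ≠ 0 := (pow_pos hLpos _).ne'
  have h2 : (((L : ℝ) ^ d)⁻¹) ^ Module.finrank ℝ 𝔤 ≠ 0 := (pow_pos (inv_pos.2 (pow_pos hLpos _)) _).ne'
  rw [abs_det_fullCoeffOn_eq hL 𝔤 hH hst hV₀ y κ hε0 hε hW hsmall hW1 h𝔤, Real.log_mul (mul_ne_zero h1 h2) hdetpos.ne',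
    Real.log_mul h1 h2, Real.log_pow, Real.log_pow, Real.log_inv, Real.log_pow]
  ring

/-- **THE SIZE OF THE LOCAL TERM: `|−log|det S(V₀, b₀(c))|_𝔤 − (d − 1)·dim 𝔤·log L| ≤ dim 𝔤·log(1/(1 − θ))`**,
`θ = 50(d+1)εL^{d}`, for every `H ≤ U1`-valued background regular at `c` — the local terms of p. 271 differ from an
explicit background-independent constant by a quantity controlled by the block-loop regularity `ε = O(L²α₀)` of the
background: «simple … functions of V_k^{(k)}», of small-field perturbative size. [cite: Balaban1985UV3, p.271 (after (62)); Balaban1985Averaging, (124)–(126) p.36, Proposition 3 p.36] -/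
theorem abs_neg_log_abs_det_fullCoeffOn_sub_le (hL : 1 ≤ L) (𝔤 : Submodule ℝ 𝔸) [FiniteDimensional ℝ 𝔤]
    {H : Subgroup 𝔸ˣ} (hH : H ≤ U1 𝔸) (hst : ∀ u : 𝔸ˣ, u ∈ H → ∀ X ∈ 𝔤, conjR u X ∈ 𝔤)
    {V₀ : Site d → Fin d → 𝔸ˣ} (hV₀ : ∀ x κ, V₀ x κ ∈ H) (y : Site d) (κ : Fin d) {ε : ℝ} (hε0 : 0 ≤ ε)
    (hε : ε ≤ 1 / 8) (hW : ∀ r : Fin d → Fin L, ‖((Wcx L V₀ (corner L y) κ (boxVec L r) : 𝔸ˣ) : 𝔸) - 1‖ ≤ ε)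
    (hsmall : 50 * (d + 1) * ε < (((L : ℝ) ^ d)⁻¹))
    (hW1 : ∀ r : Fin d → Fin L, ‖((Wcx L V₀ (corner L y) κ (boxVec L r) : 𝔸ˣ) : 𝔸) - 1‖ < 1)
    (h𝔤 : ∀ X ∈ 𝔤, fullCoeff L V₀ y κ X ∈ 𝔤) :
    |-Real.log |LinearMap.det (fullCoeffOn L 𝔤 V₀ y κ hW1 h𝔤)| - ((d : ℝ) - 1) * Module.finrank ℝ 𝔤 * Real.log L|
      ≤ Module.finrank ℝ 𝔤 * (-Real.log (1 - 50 * (d + 1) * ε * (L : ℝ) ^ d)) := by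
  rw [neg_log_abs_det_fullCoeffOn_eq hL 𝔤 hH hst hV₀ y κ hε0 hε hW hsmall hW1 h𝔤, sub_sub_cancel_left, abs_neg]
  exact abs_log_det_relCoeffOn_le hL 𝔤 hH hst hV₀ y κ hε0 hε hW hsmall hW1 h𝔤

/-- **… `≤ dim 𝔤 · θ/(1 − θ)`**, `θ = 50(d+1)εL^{d}` (first order). [cite: Balaban1985UV3, p.271 (after (62)); Balaban1985Averaging, (124)–(126) p.36] -/
theorem abs_neg_log_abs_det_fullCoeffOn_sub_le_div (hL : 1 ≤ L) (𝔤 : Submodule ℝ 𝔸) [FiniteDimensional ℝ 𝔤]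
    {H : Subgroup 𝔸ˣ} (hH : H ≤ U1 𝔸) (hst : ∀ u : 𝔸ˣ, u ∈ H → ∀ X ∈ 𝔤, conjR u X ∈ 𝔤)
    {V₀ : Site d → Fin d → 𝔸ˣ} (hV₀ : ∀ x κ, V₀ x κ ∈ H) (y : Site d) (κ : Fin d) {ε : ℝ} (hε0 : 0 ≤ ε)
    (hε : ε ≤ 1 / 8) (hW : ∀ r : Fin d → Fin L, ‖((Wcx L V₀ (corner L y) κ (boxVec L r) : 𝔸ˣ) : 𝔸) - 1‖ ≤ ε)
    (hsmall : 50 * (d + 1) * ε < (((L : ℝ) ^ d)⁻¹))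
    (hW1 : ∀ r : Fin d → Fin L, ‖((Wcx L V₀ (corner L y) κ (boxVec L r) : 𝔸ˣ) : 𝔸) - 1‖ < 1)
    (h𝔤 : ∀ X ∈ 𝔤, fullCoeff L V₀ y κ X ∈ 𝔤) :
    |-Real.log |LinearMap.det (fullCoeffOn L 𝔤 V₀ y κ hW1 h𝔤)| - ((d : ℝ) - 1) * Module.finrank ℝ 𝔤 * Real.log L|
      ≤ Module.finrank ℝ 𝔤 * (50 * (d + 1) * ε * (L : ℝ) ^ d / (1 - 50 * (d + 1) * ε * (L : ℝ) ^ d)) := by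
  rw [neg_log_abs_det_fullCoeffOn_eq hL 𝔤 hH hst hV₀ y κ hε0 hε hW hsmall hW1 h𝔤, sub_sub_cancel_left, abs_neg]
  exact abs_log_det_relCoeffOn_le_div hL 𝔤 hH hst hV₀ y κ hε0 hε hW hsmall hW1 h𝔤

/-- **FOR `H = e^𝔤 ≤ U1` (print's `G`, [4] p. 20): `−log det S(V₀, b₀(c))|_𝔤 = (d − 1)·dim 𝔤·log L − log det W(V₀, b₀(c))`**
— the `det` reading itself (`det S > 0`, `B10Eq61DetPositive.neg_log_det_fullCoeffOn_eq`). [cite: Balaban1985UV3, p.271 (after (62)); Balaban1985Averaging, p.20, (124)–(126) p.36] -/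
theorem neg_log_det_fullCoeffOn_eq_sub (hL : 1 ≤ L) (𝔤 : Submodule ℝ 𝔸) [FiniteDimensional ℝ 𝔤]
    {H : Subgroup 𝔸ˣ} (hH : H ≤ U1 𝔸) (hst : ∀ u : 𝔸ˣ, u ∈ H → ∀ X ∈ 𝔤, conjR u X ∈ 𝔤)
    (hE : ∀ X ∈ 𝔤, expUnit X ∈ H) (hexp : ∀ u : 𝔸ˣ, u ∈ H → ∃ X ∈ 𝔤, expUnit X = u)
    {V₀ : Site d → Fin d → 𝔸ˣ} (hV₀ : ∀ x κ, V₀ x κ ∈ H) (y : Site d) (κ : Fin d) {ε : ℝ} (hε0 : 0 ≤ ε)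
    (hε : ε ≤ 1 / 8) (hW : ∀ r : Fin d → Fin L, ‖((Wcx L V₀ (corner L y) κ (boxVec L r) : 𝔸ˣ) : 𝔸) - 1‖ ≤ ε)
    (hsmall : 50 * (d + 1) * ε < (((L : ℝ) ^ d)⁻¹))
    (hW1 : ∀ r : Fin d → Fin L, ‖((Wcx L V₀ (corner L y) κ (boxVec L r) : 𝔸ˣ) : 𝔸) - 1‖ < 1)
    (h𝔤 : ∀ X ∈ 𝔤, fullCoeff L V₀ y κ X ∈ 𝔤) :
    -Real.log (LinearMap.det (fullCoeffOn L 𝔤 V₀ y κ hW1 h𝔤))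
      = ((d : ℝ) - 1) * Module.finrank ℝ 𝔤 * Real.log L
          - Real.log (LinearMap.det (relCoeffOn L 𝔤 hst hV₀ y κ hW1 h𝔤)) := by
  rw [B10Eq61DetPositive.neg_log_det_fullCoeffOn_eq hL 𝔤 hH hst hE hexp hV₀ y κ hε0 hε hW hsmall hW1 h𝔤]
  exact neg_log_abs_det_fullCoeffOn_eq hL 𝔤 hH hst hV₀ y κ hε0 hε hW hsmall hW1 h𝔤

/-- **FOR `H = e^𝔤`: `|−log det S(V₀, b₀(c))|_𝔤 − (d − 1)·dim 𝔤·log L| ≤ dim 𝔤·θ/(1 − θ)`**, `θ = 50(d+1)εL^{d}` — the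
size of print's local term «−log det S(V_k^{(k)}, b₀(c))» about its flat value. [cite: Balaban1985UV3, p.271 (after (62)); Balaban1985Averaging, p.20, (124)–(126) p.36] -/
theorem abs_neg_log_det_fullCoeffOn_sub_le_div (hL : 1 ≤ L) (𝔤 : Submodule ℝ 𝔸) [FiniteDimensional ℝ 𝔤]
    {H : Subgroup 𝔸ˣ} (hH : H ≤ U1 𝔸) (hst : ∀ u : 𝔸ˣ, u ∈ H → ∀ X ∈ 𝔤, conjR u X ∈ 𝔤)
    (hE : ∀ X ∈ 𝔤, expUnit X ∈ H) (hexp : ∀ u : 𝔸ˣ, u ∈ H → ∃ X ∈ 𝔤, expUnit X = u)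
    {V₀ : Site d → Fin d → 𝔸ˣ} (hV₀ : ∀ x κ, V₀ x κ ∈ H) (y : Site d) (κ : Fin d) {ε : ℝ} (hε0 : 0 ≤ ε)
    (hε : ε ≤ 1 / 8) (hW : ∀ r : Fin d → Fin L, ‖((Wcx L V₀ (corner L y) κ (boxVec L r) : 𝔸ˣ) : 𝔸) - 1‖ ≤ ε)
    (hsmall : 50 * (d + 1) * ε < (((L : ℝ) ^ d)⁻¹))
    (hW1 : ∀ r : Fin d → Fin L, ‖((Wcx L V₀ (corner L y) κ (boxVec L r) : 𝔸ˣ) : 𝔸) - 1‖ < 1)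
    (h𝔤 : ∀ X ∈ 𝔤, fullCoeff L V₀ y κ X ∈ 𝔤) :
    |-Real.log (LinearMap.det (fullCoeffOn L 𝔤 V₀ y κ hW1 h𝔤)) - ((d : ℝ) - 1) * Module.finrank ℝ 𝔤 * Real.log L|
      ≤ Module.finrank ℝ 𝔤 * (50 * (d + 1) * ε * (L : ℝ) ^ d / (1 - 50 * (d + 1) * ε * (L : ℝ) ^ d)) := by
  rw [B10Eq61DetPositive.neg_log_det_fullCoeffOn_eq hL 𝔤 hH hst hE hexp hV₀ y κ hε0 hε hW hsmall hW1 h𝔤]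
  exact abs_neg_log_abs_det_fullCoeffOn_sub_le_div hL 𝔤 hH hst hV₀ y κ hε0 hε hW hsmall hW1 h𝔤

end LocalTerm

/-! ## §5 The flat background: `W(1, b₀(c)) = 1`, `−log det S(1, b₀(c))|_𝔤 = (d − 1)·dim 𝔤·log L` — the constant
which cancels against the second term of (61) (for the local terms, the analogue of print's remark on the Gaussian
integral's absolute constant «cancelled by the same constant from the second term in (61)»; L-41) -/

section Flat

open B7Prop1Explicit B7Prop3GeneralRotated B7Eq125RightInverse
open B7Eq78Linearization (conjR conjR_smul_real)
open B8Ineq132 (one_conjR)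
open B10Eq61SpineCoefficient (fullCoeff fullCoeffOn mainCoeffOn conjROn fullCoeff_one)

variable {d : ℕ}
variable {𝔸 : Type*} [NormedRing 𝔸] [NormedAlgebra ℂ 𝔸] [NormOneClass 𝔸] [CompleteSpace 𝔸]
variable {L : ℕ}

omit [NormedAlgebra ℂ 𝔸] [NormOneClass 𝔸] [CompleteSpace 𝔸] in
/-- the block loops of the flat background are `1`: `‖W_x(1) − 1‖ = 0` (`B8Ineq130.Wcx_one`). [cite: Balaban1985Averaging, (45) p.24] -/
theorem norm_Wcx_one_sub_one (q : Site d) (κ : Fin d) (r : Site d) :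
    ‖((Wcx L (1 : Site d → Fin d → 𝔸ˣ) q κ r : 𝔸ˣ) : 𝔸) - 1‖ = 0 := by
  rw [B8Ineq130.Wcx_one, Units.val_one, sub_self, norm_zero]

omit [NormedAlgebra ℂ 𝔸] [NormOneClass 𝔸] [CompleteSpace 𝔸] in
/-- … so the flat background is regular with `ε = 0` (`≤ ε` for every `ε ≥ 0`). [cite: Balaban1985Averaging, (45) p.24] -/
theorem norm_Wcx_one_sub_one_le {ε : ℝ} (hε0 : 0 ≤ ε) (q : Site d) (κ : Fin d) (r : Fin d → Fin L) :
    ‖((Wcx L (1 : Site d → Fin d → 𝔸ˣ) q κ (boxVec L r) : 𝔸ˣ) : 𝔸) - 1‖ ≤ ε := by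
  rw [norm_Wcx_one_sub_one]; exact hε0

-- (`< 1` at the flat background is NE7c's `B7Prop3GeneralTild.loops_flat`, used by name below and by consumers.)

/-- `S(1, b₀(c)) = L^{1−d}·id` maps every real subspace `𝔤` into itself (`fullCoeff_one`). [cite: Balaban1985Averaging, (122), (125) p.36] -/
theorem fullCoeff_one_mem (hL : 1 ≤ L) (𝔤 : Submodule ℝ 𝔸) (y : Site d) (κ : Fin d) :
    ∀ X ∈ 𝔤, fullCoeff L (1 : Site d → Fin d → 𝔸ˣ) y κ X ∈ 𝔤 := fun X hX => by
  rw [fullCoeff_one hL]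
  exact 𝔤.smul_mem _ (𝔤.smul_mem _ hX)

/-- **`W(1, b₀(c)) = 1`**: at the flat background the full coefficient IS its main term times `L` (`S(1, b₀(c)) =
L·S₀(1, b₀(c)) = L^{1−d}·id`, `fullCoeff_one`; the spine transporter is `1`). [cite: Balaban1985Averaging, (122), (125) p.36; Balaban1985UV3, (61) p.271] -/
theorem relCoeffOn_one (hL : 1 ≤ L) (𝔤 : Submodule ℝ 𝔸) {H : Subgroup 𝔸ˣ}
    (hst : ∀ u : 𝔸ˣ, u ∈ H → ∀ X ∈ 𝔤, conjR u X ∈ 𝔤) (y : Site d) (κ : Fin d)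
    (hW1 : ∀ r : Fin d → Fin L, ‖((Wcx L (1 : Site d → Fin d → 𝔸ˣ) (corner L y) κ (boxVec L r) : 𝔸ˣ) : 𝔸) - 1‖ < 1)
    (h𝔤 : ∀ X ∈ 𝔤, fullCoeff L (1 : Site d → Fin d → 𝔸ˣ) y κ X ∈ 𝔤) :
    relCoeffOn L 𝔤 hst (V₀ := 1) (fun _ _ => H.one_mem) y κ hW1 h𝔤 = LinearMap.id := by
  have hLne : (L : ℝ) ≠ 0 := by exact_mod_cast (Nat.one_le_iff_ne_zero.1 hL)
  ext X
  rw [relCoeffOn_apply, LinearMap.id_apply, B8Ineq130.hol_one, inv_one, one_conjR, fullCoeff_one hL, smul_smul,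
    smul_smul]
  have hc : (L : ℝ)⁻¹ * (L : ℝ) ^ d * (L : ℝ) * (((L : ℝ) ^ d)⁻¹) = 1 := by field_simp
  rw [hc, one_smul]

/-- hence **`det W(1, b₀(c)) = 1`**. [cite: Balaban1985UV3, (61) p.271; Balaban1985Averaging, (125) p.36] -/
theorem det_relCoeffOn_one (hL : 1 ≤ L) (𝔤 : Submodule ℝ 𝔸) {H : Subgroup 𝔸ˣ}
    (hst : ∀ u : 𝔸ˣ, u ∈ H → ∀ X ∈ 𝔤, conjR u X ∈ 𝔤) (y : Site d) (κ : Fin d)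
    (hW1 : ∀ r : Fin d → Fin L, ‖((Wcx L (1 : Site d → Fin d → 𝔸ˣ) (corner L y) κ (boxVec L r) : 𝔸ˣ) : 𝔸) - 1‖ < 1)
    (h𝔤 : ∀ X ∈ 𝔤, fullCoeff L (1 : Site d → Fin d → 𝔸ˣ) y κ X ∈ 𝔤) :
    LinearMap.det (relCoeffOn L 𝔤 hst (V₀ := 1) (fun _ _ => H.one_mem) y κ hW1 h𝔤) = 1 := by
  rw [relCoeffOn_one hL 𝔤 hst y κ hW1 h𝔤, LinearMap.det_id]

/-- **THE FLAT VALUE OF THE LOCAL TERM: `−log|det S(1, b₀(c))|_𝔤 = (d − 1)·dim 𝔤·log L` EXACTLY** — the second term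
of (61) (background `1`) carries this constant at every coarse bond. [cite: Balaban1985UV3, (61) p.271, p.271 (after (62)); Balaban1985Averaging, (125) p.36] -/
theorem neg_log_abs_det_fullCoeffOn_one (hL : 1 ≤ L) (𝔤 : Submodule ℝ 𝔸) [FiniteDimensional ℝ 𝔤]
    {H : Subgroup 𝔸ˣ} (hH : H ≤ U1 𝔸) (hst : ∀ u : 𝔸ˣ, u ∈ H → ∀ X ∈ 𝔤, conjR u X ∈ 𝔤) (y : Site d) (κ : Fin d)
    (hW1 : ∀ r : Fin d → Fin L, ‖((Wcx L (1 : Site d → Fin d → 𝔸ˣ) (corner L y) κ (boxVec L r) : 𝔸ˣ) : 𝔸) - 1‖ < 1)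
    (h𝔤 : ∀ X ∈ 𝔤, fullCoeff L (1 : Site d → Fin d → 𝔸ˣ) y κ X ∈ 𝔤) :
    -Real.log |LinearMap.det (fullCoeffOn L 𝔤 (1 : Site d → Fin d → 𝔸ˣ) y κ hW1 h𝔤)|
      = ((d : ℝ) - 1) * Module.finrank ℝ 𝔤 * Real.log L := by
  have hsmall : 50 * (d + 1) * (0 : ℝ) < (((L : ℝ) ^ d)⁻¹) := by
    rw [mul_zero]; exact inv_pos.2 (by positivity)
  rw [neg_log_abs_det_fullCoeffOn_eq hL 𝔤 hH hst (V₀ := 1) (fun _ _ => H.one_mem) y κ le_rfl (by norm_num)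
    (norm_Wcx_one_sub_one_le le_rfl (corner L y) κ) hsmall hW1 h𝔤, det_relCoeffOn_one hL 𝔤 hst y κ hW1 h𝔤,
    Real.log_one, sub_zero]

/-- **THE (61)-DIFFERENCE OF THE LOCAL TERMS AT ONE COARSE BOND**: `[−log|det S(V₀, b₀(c))|] − [−log|det S(1, b₀(c))|]
= −log det W(V₀, b₀(c))` — the constant `(d − 1)·dim 𝔤·log L` cancels against the second term of (61) (as print says
of the Gaussian integral's absolute constant: «cancelled by the same constant from the second term in (61)»); what
remains is the logarithm of the relative coefficient. [cite: Balaban1985UV3, (61) p.271, p.271 (after (62)); Balaban1985Averaging, (124)–(126) p.36] -/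
theorem neg_log_abs_det_sub_flat_eq (hL : 1 ≤ L) (𝔤 : Submodule ℝ 𝔸) [FiniteDimensional ℝ 𝔤]
    {H : Subgroup 𝔸ˣ} (hH : H ≤ U1 𝔸) (hst : ∀ u : 𝔸ˣ, u ∈ H → ∀ X ∈ 𝔤, conjR u X ∈ 𝔤)
    {V₀ : Site d → Fin d → 𝔸ˣ} (hV₀ : ∀ x κ, V₀ x κ ∈ H) (y : Site d) (κ : Fin d) {ε : ℝ} (hε0 : 0 ≤ ε)
    (hε : ε ≤ 1 / 8) (hW : ∀ r : Fin d → Fin L, ‖((Wcx L V₀ (corner L y) κ (boxVec L r) : 𝔸ˣ) : 𝔸) - 1‖ ≤ ε)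
    (hsmall : 50 * (d + 1) * ε < (((L : ℝ) ^ d)⁻¹))
    (hW1 : ∀ r : Fin d → Fin L, ‖((Wcx L V₀ (corner L y) κ (boxVec L r) : 𝔸ˣ) : 𝔸) - 1‖ < 1)
    (h𝔤 : ∀ X ∈ 𝔤, fullCoeff L V₀ y κ X ∈ 𝔤)
    (hW1' : ∀ r : Fin d → Fin L, ‖((Wcx L (1 : Site d → Fin d → 𝔸ˣ) (corner L y) κ (boxVec L r) : 𝔸ˣ) : 𝔸) - 1‖ < 1)
    (h𝔤' : ∀ X ∈ 𝔤, fullCoeff L (1 : Site d → Fin d → 𝔸ˣ) y κ X ∈ 𝔤) :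
    -Real.log |LinearMap.det (fullCoeffOn L 𝔤 V₀ y κ hW1 h𝔤)|
        - -Real.log |LinearMap.det (fullCoeffOn L 𝔤 (1 : Site d → Fin d → 𝔸ˣ) y κ hW1' h𝔤')|
      = -Real.log (LinearMap.det (relCoeffOn L 𝔤 hst hV₀ y κ hW1 h𝔤)) := by
  rw [neg_log_abs_det_fullCoeffOn_eq hL 𝔤 hH hst hV₀ y κ hε0 hε hW hsmall hW1 h𝔤,
    neg_log_abs_det_fullCoeffOn_one hL 𝔤 hH hst y κ hW1' h𝔤']
  ring

/-- **… and its size: `≤ dim 𝔤·θ/(1 − θ)`**, `θ = 50(d+1)εL^{d}` — per coarse bond the local Jacobian terms of (61)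
contribute at most `dim 𝔤·θ/(1 − θ)`, `θ = O(L^{d+2}α₀)` (§6). [cite: Balaban1985UV3, (61) p.271, p.271 (after (62)); Balaban1985Averaging, (124)–(126) p.36] -/
theorem abs_neg_log_abs_det_sub_flat_le_div (hL : 1 ≤ L) (𝔤 : Submodule ℝ 𝔸) [FiniteDimensional ℝ 𝔤]
    {H : Subgroup 𝔸ˣ} (hH : H ≤ U1 𝔸) (hst : ∀ u : 𝔸ˣ, u ∈ H → ∀ X ∈ 𝔤, conjR u X ∈ 𝔤)
    {V₀ : Site d → Fin d → 𝔸ˣ} (hV₀ : ∀ x κ, V₀ x κ ∈ H) (y : Site d) (κ : Fin d) {ε : ℝ} (hε0 : 0 ≤ ε)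
    (hε : ε ≤ 1 / 8) (hW : ∀ r : Fin d → Fin L, ‖((Wcx L V₀ (corner L y) κ (boxVec L r) : 𝔸ˣ) : 𝔸) - 1‖ ≤ ε)
    (hsmall : 50 * (d + 1) * ε < (((L : ℝ) ^ d)⁻¹))
    (hW1 : ∀ r : Fin d → Fin L, ‖((Wcx L V₀ (corner L y) κ (boxVec L r) : 𝔸ˣ) : 𝔸) - 1‖ < 1)
    (h𝔤 : ∀ X ∈ 𝔤, fullCoeff L V₀ y κ X ∈ 𝔤)
    (hW1' : ∀ r : Fin d → Fin L, ‖((Wcx L (1 : Site d → Fin d → 𝔸ˣ) (corner L y) κ (boxVec L r) : 𝔸ˣ) : 𝔸) - 1‖ < 1)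
    (h𝔤' : ∀ X ∈ 𝔤, fullCoeff L (1 : Site d → Fin d → 𝔸ˣ) y κ X ∈ 𝔤) :
    |-Real.log |LinearMap.det (fullCoeffOn L 𝔤 V₀ y κ hW1 h𝔤)|
        - (-Real.log |LinearMap.det (fullCoeffOn L 𝔤 (1 : Site d → Fin d → 𝔸ˣ) y κ hW1' h𝔤')|)|
      ≤ Module.finrank ℝ 𝔤 * (50 * (d + 1) * ε * (L : ℝ) ^ d / (1 - 50 * (d + 1) * ε * (L : ℝ) ^ d)) := by
  rw [neg_log_abs_det_sub_flat_eq hL 𝔤 hH hst hV₀ y κ hε0 hε hW hsmall hW1 h𝔤 hW1' h𝔤', abs_neg]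
  exact abs_log_det_relCoeffOn_le_div hL 𝔤 hH hst hV₀ y κ hε0 hε hW hsmall hW1 h𝔤

end Flat

/-! ## §6 Under the plaquette regularity (44) `|V₀(∂p) − 1| ≦ α₀`: `θ = 800(d+1)²(d+4)L^{d+2}α₀` (Propositions 1 and 3 of [4]) -/

section Plaquette

open B7Prop1Explicit B7Prop3GeneralRotated B7Eq125RightInverse
open B7Eq78Linearization (conjR)
open B10Eq61SpineCoefficient (fullCoeff fullCoeffOn)

variable {d : ℕ}
variable {𝔸 : Type*} [NormedRing 𝔸] [NormedAlgebra ℂ 𝔸] [NormOneClass 𝔸] [CompleteSpace 𝔸]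
variable {L : ℕ}

/-- the `c₃` window `α₀ < L^{−(d+2)}/(800(d+1)²(d+4))` of `B10Eq61SpineCoefficient.fullCoeff_injective_of_c3` gives the
two conditions of Proposition 1's block-loop bound and `θ = 800(d+1)²(d+4)L^{d+2}α₀ < 1` (bookkeeping).
[cite: Balaban1985Averaging, Proposition 3 p.36 («c₃ depends on d and L»), (44) p.24, (109) p.34] -/
theorem c3_window (hL : 1 ≤ L) {α₀ : ℝ} (hα₀ : 0 ≤ α₀)
    (hc3 : α₀ < ((L : ℝ) ^ (d + 2) * (800 * (d + 1) ^ 2 * (d + 4)))⁻¹) :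
    512 * (d + 1) * (d + 4) * (L : ℝ) ^ 2 * α₀ ≤ 1
      ∧ 2 * (8 * (d + 1) * (d + 4) * (L : ℝ) ^ 2 * α₀) ≤ 1 / 8
      ∧ 50 * (d + 1) * (2 * (8 * (d + 1) * (d + 4) * (L : ℝ) ^ 2 * α₀)) < (((L : ℝ) ^ d)⁻¹)
      ∧ 50 * (d + 1) * (2 * (8 * (d + 1) * (d + 4) * (L : ℝ) ^ 2 * α₀)) * (L : ℝ) ^ d
          = 800 * (d + 1) ^ 2 * (d + 4) * (L : ℝ) ^ (d + 2) * α₀ := by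
  have hLpos : (0 : ℝ) < L := by exact_mod_cast hL
  have hL1 : (1 : ℝ) ≤ L := by exact_mod_cast hL
  have hd : (0 : ℝ) ≤ d := Nat.cast_nonneg d
  have hK : (0 : ℝ) < 800 * (d + 1) ^ 2 * (d + 4) := by positivity
  have hsmall₂ : 800 * (d + 1) ^ 2 * (d + 4) * (L : ℝ) ^ 2 * α₀ < (((L : ℝ) ^ d)⁻¹) := by
    have h1 := mul_lt_mul_of_pos_left hc3 (mul_pos hK (pow_pos hLpos 2))
    have h2 : 800 * (d + 1) ^ 2 * (d + 4) * (L : ℝ) ^ 2 * ((L : ℝ) ^ (d + 2) * (800 * (d + 1) ^ 2 * (d + 4)))⁻¹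
        = (((L : ℝ) ^ d)⁻¹) := by
      field_simp
      ring
    calc 800 * (d + 1) ^ 2 * (d + 4) * (L : ℝ) ^ 2 * α₀
        < 800 * (d + 1) ^ 2 * (d + 4) * (L : ℝ) ^ 2 * ((L : ℝ) ^ (d + 2) * (800 * (d + 1) ^ 2 * (d + 4)))⁻¹ := h1
      _ = (((L : ℝ) ^ d)⁻¹) := h2
  have hinv1 : (((L : ℝ) ^ d)⁻¹) ≤ 1 := inv_le_one_of_one_le₀ (one_le_pow₀ hL1)
  have hrest : (0 : ℝ) ≤ (d + 4) * (L : ℝ) ^ 2 * α₀ := by positivity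
  have hsmall₁ : 512 * (d + 1) * (d + 4) * (L : ℝ) ^ 2 * α₀ ≤ 1 := by
    have : (512 : ℝ) * (d + 1) ≤ 800 * (d + 1) ^ 2 := by nlinarith
    nlinarith
  refine ⟨hsmall₁, by nlinarith, by nlinarith, by ring⟩

/-- **THE SIZE OF THE LOCAL TERM UNDER (44)**: for an `H ≤ U1`-valued background with `|V₀(∂p) − 1| ≦ α₀` for all
plaquettes and `α₀` in the `c₃` window `α₀ < L^{−(d+2)}/(800(d+1)²(d+4))`,
`|−log|det S(V₀, b₀(c))|_𝔤 − (d − 1)·dim 𝔤·log L| ≤ dim 𝔤·θ/(1 − θ)` with `θ = 800(d+1)²(d+4)L^{d+2}α₀` — the block loops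
are within `ε = 16(d+1)(d+4)L²α₀` of `1` by Proposition 1 (`B7Prop2Explicit.norm_Wcx_sub_one_le`), and §4 applies:
the local terms of (61) are `O(L^{d+2}α₀)·dim 𝔤` perturbations of a background-independent constant.
[cite: Balaban1985UV3, p.271 (after (62)); Balaban1985Averaging, (44) p.24, Proposition 1 p.26, (109) p.34, (124)–(126) p.36, Proposition 3 p.36] -/
theorem abs_neg_log_abs_det_fullCoeffOn_sub_le_of_plaquette (hL : 1 ≤ L) (𝔤 : Submodule ℝ 𝔸)
    [FiniteDimensional ℝ 𝔤] {H : Subgroup 𝔸ˣ} (hH : H ≤ U1 𝔸)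
    (hst : ∀ u : 𝔸ˣ, u ∈ H → ∀ X ∈ 𝔤, conjR u X ∈ 𝔤) {V₀ : Site d → Fin d → 𝔸ˣ} (hV₀ : ∀ x κ, V₀ x κ ∈ H)
    {α₀ : ℝ} (hα₀ : 0 ≤ α₀) (hc3 : α₀ < ((L : ℝ) ^ (d + 2) * (800 * (d + 1) ^ 2 * (d + 4)))⁻¹)
    (h44 : ∀ (x : Site d) (μ ν : Fin d), μ ≠ ν → ‖((hol V₀ x (plaqWord μ ν) : 𝔸ˣ) : 𝔸) - 1‖ ≤ α₀)
    (y : Site d) (κ : Fin d)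
    (hW1 : ∀ r : Fin d → Fin L, ‖((Wcx L V₀ (corner L y) κ (boxVec L r) : 𝔸ˣ) : 𝔸) - 1‖ < 1)
    (h𝔤 : ∀ X ∈ 𝔤, fullCoeff L V₀ y κ X ∈ 𝔤) :
    |-Real.log |LinearMap.det (fullCoeffOn L 𝔤 V₀ y κ hW1 h𝔤)| - ((d : ℝ) - 1) * Module.finrank ℝ 𝔤 * Real.log L|
      ≤ Module.finrank ℝ 𝔤 * (800 * (d + 1) ^ 2 * (d + 4) * (L : ℝ) ^ (d + 2) * α₀
          / (1 - 800 * (d + 1) ^ 2 * (d + 4) * (L : ℝ) ^ (d + 2) * α₀)) := by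
  obtain ⟨hsmall₁, hε, hsmall, hθ⟩ := c3_window (d := d) hL hα₀ hc3
  have hU : ∀ x κ, V₀ x κ ∈ U1 𝔸 := fun x κ => hH (hV₀ x κ)
  have hW : ∀ r : Fin d → Fin L, ‖((Wcx L V₀ (corner L y) κ (boxVec L r) : 𝔸ˣ) : 𝔸) - 1‖
      ≤ 2 * (8 * (d + 1) * (d + 4) * (L : ℝ) ^ 2 * α₀) :=
    fun r => B7Prop2Explicit.norm_Wcx_sub_one_le L hL V₀ hU hα₀ hsmall₁ h44 (corner L y) κ r
  have h := abs_neg_log_abs_det_fullCoeffOn_sub_le_div hL 𝔤 hH hst hV₀ y κ (by positivity) hε hW hsmall hW1 h𝔤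
  rwa [hθ] at h

/-- Under (44) in the `c₃` window the block loops ARE within `1` of `1` — the hypothesis `hW1` of `fullCoeffOn` supplied
(bookkeeping, so that the previous theorem's `hW1` is not an extra assumption). [cite: Balaban1985Averaging, Proposition 1 p.26, (44) p.24] -/
theorem norm_Wcx_sub_one_lt_one_of_plaquette (hL : 1 ≤ L) {H : Subgroup 𝔸ˣ} (hH : H ≤ U1 𝔸)
    {V₀ : Site d → Fin d → 𝔸ˣ} (hV₀ : ∀ x κ, V₀ x κ ∈ H)
    {α₀ : ℝ} (hα₀ : 0 ≤ α₀) (hc3 : α₀ < ((L : ℝ) ^ (d + 2) * (800 * (d + 1) ^ 2 * (d + 4)))⁻¹)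
    (h44 : ∀ (x : Site d) (μ ν : Fin d), μ ≠ ν → ‖((hol V₀ x (plaqWord μ ν) : 𝔸ˣ) : 𝔸) - 1‖ ≤ α₀)
    (y : Site d) (κ : Fin d) (r : Fin d → Fin L) :
    ‖((Wcx L V₀ (corner L y) κ (boxVec L r) : 𝔸ˣ) : 𝔸) - 1‖ < 1 := by
  obtain ⟨hsmall₁, hε, -, -⟩ := c3_window (d := d) hL hα₀ hc3
  have hU : ∀ x κ, V₀ x κ ∈ U1 𝔸 := fun x κ => hH (hV₀ x κ)
  exact (B7Prop2Explicit.norm_Wcx_sub_one_le L hL V₀ hU hα₀ hsmall₁ h44 (corner L y) κ r).trans_lt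
    (hε.trans_lt (by norm_num))

end Plaquette

/-! ## §7 Summed over the coarse bonds: the local Jacobian terms of (61) («the sum of terms −log det S(V_k^{(k)}, b₀(c))») -/

section Sum

open B7Prop1Explicit B7Prop3GeneralRotated B7Eq125RightInverse
open B7Eq78Linearization (conjR)
open B10Eq61SpineCoefficient (fullCoeff fullCoeffOn)

variable {d : ℕ}
variable {𝔸 : Type*} [NormedRing 𝔸] [NormedAlgebra ℂ 𝔸] [NormOneClass 𝔸] [CompleteSpace 𝔸]
variable {L : ℕ}

/-- **THE SUM OF THE LOCAL TERMS OVER A FINITE SET OF COARSE BONDS**: if the background is regular at every coarse bond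
`c i = (y i, κ i)`, `i ∈ s` (block loops within `ε ≦ 1/8`, `50(d+1)ε < L^{−d}`), then
`|Σ_{i∈s} ([−log|det S(V₀, b₀(c_i))|] − [−log|det S(1, b₀(c_i))|])| ≤ |s|·dim 𝔤·θ/(1 − θ)`, `θ = 50(d+1)εL^{d}` — the
(61)-difference of «the sum of terms −log det S(V_k^{(k)}, b₀(c))» is at most `dim 𝔤·θ/(1 − θ)` per coarse bond (the
`Σ_c` of `B10Eq61EliminationTerms.logZ_sub_logZ_eq`). [cite: Balaban1985UV3, (61) p.271, p.271 (after (62)); Balaban1985Averaging, (124)–(126) p.36] -/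
theorem abs_sum_neg_log_abs_det_sub_flat_le {ι : Type*} (s : Finset ι) (hL : 1 ≤ L) (𝔤 : Submodule ℝ 𝔸)
    [FiniteDimensional ℝ 𝔤] {H : Subgroup 𝔸ˣ} (hH : H ≤ U1 𝔸)
    (hst : ∀ u : 𝔸ˣ, u ∈ H → ∀ X ∈ 𝔤, conjR u X ∈ 𝔤) {V₀ : Site d → Fin d → 𝔸ˣ} (hV₀ : ∀ x κ, V₀ x κ ∈ H)
    (y : ι → Site d) (κ : ι → Fin d) {ε : ℝ} (hε0 : 0 ≤ ε) (hε : ε ≤ 1 / 8)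
    (hW : ∀ i (r : Fin d → Fin L), ‖((Wcx L V₀ (corner L (y i)) (κ i) (boxVec L r) : 𝔸ˣ) : 𝔸) - 1‖ ≤ ε)
    (hsmall : 50 * (d + 1) * ε < (((L : ℝ) ^ d)⁻¹))
    (hW1 : ∀ i (r : Fin d → Fin L), ‖((Wcx L V₀ (corner L (y i)) (κ i) (boxVec L r) : 𝔸ˣ) : 𝔸) - 1‖ < 1)
    (h𝔤 : ∀ i, ∀ X ∈ 𝔤, fullCoeff L V₀ (y i) (κ i) X ∈ 𝔤)
    (hW1' : ∀ i (r : Fin d → Fin L),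
      ‖((Wcx L (1 : Site d → Fin d → 𝔸ˣ) (corner L (y i)) (κ i) (boxVec L r) : 𝔸ˣ) : 𝔸) - 1‖ < 1)
    (h𝔤' : ∀ i, ∀ X ∈ 𝔤, fullCoeff L (1 : Site d → Fin d → 𝔸ˣ) (y i) (κ i) X ∈ 𝔤) :
    |∑ i ∈ s, (-Real.log |LinearMap.det (fullCoeffOn L 𝔤 V₀ (y i) (κ i) (hW1 i) (h𝔤 i))|
        - (-Real.log |LinearMap.det (fullCoeffOn L 𝔤 (1 : Site d → Fin d → 𝔸ˣ) (y i) (κ i) (hW1' i) (h𝔤' i))|))|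
      ≤ s.card * (Module.finrank ℝ 𝔤
          * (50 * (d + 1) * ε * (L : ℝ) ^ d / (1 - 50 * (d + 1) * ε * (L : ℝ) ^ d))) := by
  refine (Finset.abs_sum_le_sum_abs _ _).trans ?_
  have h := Finset.sum_le_card_nsmul s (fun i =>
      |-Real.log |LinearMap.det (fullCoeffOn L 𝔤 V₀ (y i) (κ i) (hW1 i) (h𝔤 i))|
        - (-Real.log |LinearMap.det (fullCoeffOn L 𝔤 (1 : Site d → Fin d → 𝔸ˣ) (y i) (κ i) (hW1' i) (h𝔤' i))|)|)
    (Module.finrank ℝ 𝔤 * (50 * (d + 1) * ε * (L : ℝ) ^ d / (1 - 50 * (d + 1) * ε * (L : ℝ) ^ d)))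
    (fun i _ => abs_neg_log_abs_det_sub_flat_le_div hL 𝔤 hH hst hV₀ (y i) (κ i) hε0 hε (hW i) hsmall (hW1 i)
      (h𝔤 i) (hW1' i) (h𝔤' i))
  rwa [nsmul_eq_mul] at h

end Sum

/-! ## §8 Gauge invariance of `det W(V₀, b₀(c))` («gauge invariant functions of V_k^{(k)}») -/

section Gauge

open B7Prop1Explicit B7Prop3GeneralRotated B7Eq125RightInverse
open B7Eq78Linearization (conjR)
open B7Prop2Explicit (hol_mem_of)
open B10Eq61SpineCoefficient (fullCoeff fullCoeffOn conjROn abs_det_conjROn abs_det_fullCoeffOn_gaugeAct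
  norm_Wcx_gaugeAct_sub_one fullCoeff_gaugeAct_mem)

variable {d : ℕ}
variable {𝔸 : Type*} [NormedRing 𝔸] [NormedAlgebra ℂ 𝔸] [NormOneClass 𝔸] [CompleteSpace 𝔸]
variable {L : ℕ}

omit [NormedAlgebra ℂ 𝔸] [NormOneClass 𝔸] [CompleteSpace 𝔸] in
/-- an `H`-valued gauge transformation of an `H`-valued background is `H`-valued ((8) of [4]). [cite: Balaban1985Averaging, (8) p.18] -/
theorem gaugeAct_mem_subgroup {H : Subgroup 𝔸ˣ} {V₀ : Site d → Fin d → 𝔸ˣ} (hV₀ : ∀ x κ, V₀ x κ ∈ H)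
    {u : Site d → 𝔸ˣ} (hu : ∀ x, u x ∈ H) (x : Site d) (κ : Fin d) : gaugeAct u V₀ x κ ∈ H :=
  H.mul_mem (H.mul_mem (hu x) (hV₀ x κ)) (H.inv_mem (hu _))

/-- **`det W(V₀^g, b₀(c)) = det W(V₀, b₀(c))`** for `H`-valued gauge transformations `g`: the relative coefficient's
determinant — the background-DEPENDENT part `−log det W` of the local term — is a gauge invariant function of the
background (`|det S|` is gauge invariant, `abs_det_fullCoeffOn_gaugeAct`; `|det S₀|` is background-free; `det W > 0`).
[cite: Balaban1985UV3, p.271 (after (62)); Balaban1985Averaging, (8) p.18, (45) p.24] -/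
theorem det_relCoeffOn_gaugeAct (hL : 1 ≤ L) (𝔤 : Submodule ℝ 𝔸) [FiniteDimensional ℝ 𝔤] {H : Subgroup 𝔸ˣ}
    (hH : H ≤ U1 𝔸) (hst : ∀ u : 𝔸ˣ, u ∈ H → ∀ X ∈ 𝔤, conjR u X ∈ 𝔤)
    {g : Site d → 𝔸ˣ} (hg : ∀ x, g x ∈ H) {V₀ : Site d → Fin d → 𝔸ˣ} (hV₀ : ∀ x κ, V₀ x κ ∈ H)
    (y : Site d) (κ : Fin d) {ε : ℝ} (hε0 : 0 ≤ ε) (hε : ε ≤ 1 / 8)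
    (hW : ∀ r : Fin d → Fin L, ‖((Wcx L V₀ (corner L y) κ (boxVec L r) : 𝔸ˣ) : 𝔸) - 1‖ ≤ ε)
    (hsmall : 50 * (d + 1) * ε < (((L : ℝ) ^ d)⁻¹))
    (hW1 : ∀ r : Fin d → Fin L, ‖((Wcx L V₀ (corner L y) κ (boxVec L r) : 𝔸ˣ) : 𝔸) - 1‖ < 1)
    (h𝔤 : ∀ X ∈ 𝔤, fullCoeff L V₀ y κ X ∈ 𝔤) :
    LinearMap.det (relCoeffOn L 𝔤 hst (gaugeAct_mem_subgroup hV₀ hg) y κ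
        (fun r => (norm_Wcx_gaugeAct_sub_one (fun x => hH (hg x)) V₀ _ κ _).trans_lt (hW1 r))
        (fullCoeff_gaugeAct_mem 𝔤 hst hg V₀ y κ h𝔤))
      = LinearMap.det (relCoeffOn L 𝔤 hst hV₀ y κ hW1 h𝔤) := by
  have hLpos : (0 : ℝ) < L := by exact_mod_cast hL
  have hWg : ∀ r : Fin d → Fin L, ‖((Wcx L (gaugeAct g V₀) (corner L y) κ (boxVec L r) : 𝔸ˣ) : 𝔸) - 1‖ ≤ ε :=
    fun r => (norm_Wcx_gaugeAct_sub_one (fun x => hH (hg x)) V₀ _ κ _).trans_le (hW r)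
  have h1 := abs_det_fullCoeffOn_eq hL 𝔤 hH hst (gaugeAct_mem_subgroup hV₀ hg) y κ hε0 hε hWg hsmall
    (fun r => (norm_Wcx_gaugeAct_sub_one (fun x => hH (hg x)) V₀ _ κ _).trans_lt (hW1 r))
    (fullCoeff_gaugeAct_mem 𝔤 hst hg V₀ y κ h𝔤)
  have h0 := abs_det_fullCoeffOn_eq hL 𝔤 hH hst hV₀ y κ hε0 hε hW hsmall hW1 h𝔤
  rw [abs_det_fullCoeffOn_gaugeAct 𝔤 hH hst hg V₀ y κ hW1 h𝔤, h0] at h1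
  have hc : (0 : ℝ) < (L : ℝ) ^ Module.finrank ℝ 𝔤 * (((L : ℝ) ^ d)⁻¹) ^ Module.finrank ℝ 𝔤 := by positivity
  exact (mul_left_cancel₀ hc.ne' h1).symm

end Gauge

/-! ## §9 `G = U(N)`, `𝔤 = 𝔲(N)`: every hypothesis about `𝔤` and `G` discharged ((23) of [4]; `B10Eq61DetPositive` §5) -/

section Unitary

open scoped Matrix.Norms.L2Operator
open B7Prop1Explicit B7Prop3GeneralRotated B7Eq125RightInverse
open B7Eq78Linearization (conjR)
open B7Prop2Explicit (unitaryUnits mem_unitaryUnits unitaryUnits_le_U1)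
open B10Eq61SpineCoefficient (fullCoeff fullCoeffOn)
open B10Eq61CoefficientOnLie (expUnit_mem_of_logChart fullCoeff_mem_skewAdjoint)
open B10Eq61DetPositive (exists_skewAdjoint_expUnit_eq)

variable {d : ℕ}
variable {n : Type*} [Fintype n] [DecidableEq n] [Nonempty n]
variable {L : ℕ}

/-- **THE SIZE OF THE LOCAL TERM FOR UNITARY BACKGROUNDS**: for a `U(N)`-valued background regular at `c` (block loops
within `ε ≦ 1/8` of `1` in the operator norm (19), `50(d+1)ε < L^{−d}`),
`|−log det S(V₀, b₀(c))|_{𝔲(N)} − (d − 1)·dim 𝔲(N)·log L| ≦ dim 𝔲(N)·θ/(1 − θ)`, `θ = 50(d+1)εL^{d}` — `S𝔲(N) ⊆ 𝔲(N)`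
by `B10Eq61CoefficientOnLie.fullCoeff_mem_skewAdjoint` (chart radius `1/3`), `U(N) = e^{𝔲(N)}` by (23) of [4]
(`B10Eq61DetPositive.exists_skewAdjoint_expUnit_eq`), `Ad(U(N))𝔲(N) ⊆ 𝔲(N)` by the `U(N)` log-chart.
[cite: Balaban1985UV3, p.271 (after (62)); Balaban1985Averaging, p.20, (19) p.21, (23) p.21, (124)–(126) p.36] -/
theorem abs_neg_log_det_fullCoeffOn_sub_le_div_unitary (hL : 1 ≤ L) {V₀ : Site d → Fin d → (Matrix n n ℂ)ˣ}
    (hV₀ : ∀ z μ, V₀ z μ ∈ unitaryUnits (Matrix n n ℂ)) (y : Site d) (κ : Fin d) {ε : ℝ} (hε0 : 0 ≤ ε)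
    (hε : ε ≤ 1 / 8)
    (hW : ∀ r : Fin d → Fin L, ‖((Wcx L V₀ (corner L y) κ (boxVec L r) : (Matrix n n ℂ)ˣ) : Matrix n n ℂ) - 1‖ ≤ ε)
    (hsmall : 50 * (d + 1) * ε < (((L : ℝ) ^ d)⁻¹))
    (hW1 : ∀ r : Fin d → Fin L, ‖((Wcx L V₀ (corner L y) κ (boxVec L r) : (Matrix n n ℂ)ˣ) : Matrix n n ℂ) - 1‖ < 1) :
    |-Real.log (LinearMap.det (fullCoeffOn L (skewAdjoint.submodule ℝ (Matrix n n ℂ)) V₀ y κ hW1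
          (fullCoeff_mem_skewAdjoint hV₀ y κ fun r => (hW r).trans_lt (by linarith))))
        - ((d : ℝ) - 1) * Module.finrank ℝ (skewAdjoint.submodule ℝ (Matrix n n ℂ)) * Real.log L|
      ≤ Module.finrank ℝ (skewAdjoint.submodule ℝ (Matrix n n ℂ))
          * (50 * (d + 1) * ε * (L : ℝ) ^ d / (1 - 50 * (d + 1) * ε * (L : ℝ) ^ d)) := by
  letI : CStarAlgebra (Matrix n n ℂ) := {}
  exact abs_neg_log_det_fullCoeffOn_sub_le_div (H := unitaryUnits (Matrix n n ℂ)) hL _ unitaryUnits_le_U1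
    ((unitaryLogChart n).conjR_mem_lie fun _ => mem_unitaryUnits)
    (expUnit_mem_of_logChart (unitaryLogChart n) fun _ => mem_unitaryUnits)
    (fun u hu => exists_skewAdjoint_expUnit_eq hu) hV₀ y κ hε0 hε hW hsmall hW1 _

end Unitary


/-! ## §10 (v1.1) In the letters of (61): `log Z^{(k)}(·, U_{k+1}) − log Z^{(k)}(·, 1) = [Gaussian bracket] − R`,
`|R| ≤ |o|·dim 𝔤·θ/(1 − θ)` for the full `b₀(c)`-coefficient blocks (`B10Eq61EliminationTerms.logZ_sub_logZ_eq` knit) -/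

section Bracket

open MeasureTheory B7Prop1Explicit B7Prop3GeneralRotated B7Eq125RightInverse
open B7Eq78Linearization (conjR)
open B10Eq55GaussianStep B10Eq61EliminationTerms
open B10Eq61SpineCoefficient (fullCoeff fullCoeffOn)

variable {d : ℕ}
variable {𝔸 : Type*} [NormedRing 𝔸] [NormedAlgebra ℂ 𝔸] [NormOneClass 𝔸] [CompleteSpace 𝔸]
variable {L : ℕ}
variable {o : Type*} [Fintype o] [DecidableEq o]

/-- **(61) FOR THE FULL `b₀(c)`-COEFFICIENT BLOCKS: THE LOCAL JACOBIAN TERMS ARE `O(|o|·dim 𝔤·θ)`**.  If the `κ`-blocks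
of the two constrained normalisations of (61) (backgrounds `U_{k+1}` and `1`) are block-diagonal over the coarse bonds
`c ∈ o` with blocks THE MATRICES (in a basis `b` of `𝔤`) of the full coefficients `S(U_{k+1}, b₀(c))`, `S(1, b₀(c))` at
the coarse bonds `(y c, κ c)`, the background `U_{k+1}` being `H ≤ U1`-valued and regular at every `c` (block loops within
`ε ≦ 1/8` of `1`, `50(d+1)ε < L^{−d}`), then
`|[log Z^{(k)}(·,U_{k+1}) − log Z^{(k)}(·,1)] − [log Zk(C₁*Δ_k(U)C₁) − log Zk(C₀*Δ_k(1)C₀)]| ≤ |o|·dim 𝔤·θ/(1 − θ)`,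
`θ = 50(d+1)εL^{d}` — `B10Eq61EliminationTerms.logZ_sub_logZ_eq` (the split) + §7 (the size); the invertibility
hypotheses `hκ` of the split are DERIVED from `det S ≠ 0`.  (For main-term blocks the bracket is exact,
`B10Eq61SpineCoefficient.logZ_sub_logZ_eq_of_mainCoeffOn_blocks`.)
[cite: Balaban1985UV3, (61) p.271, p.271 (after (62)); Balaban1985Averaging, (124)–(126) p.36; Balaban1985BackgroundPropagators, (3.157) p.428] -/
theorem abs_logZ_sub_logZ_sub_bracket_le (hL : 1 ≤ L) (𝔤 : Submodule ℝ 𝔸) [FiniteDimensional ℝ 𝔤]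
    {ι : Type*} [Fintype ι] [DecidableEq ι] (b : Module.Basis ι ℝ 𝔤) {H : Subgroup 𝔸ˣ} (hH : H ≤ U1 𝔸)
    (hst : ∀ u : 𝔸ˣ, u ∈ H → ∀ X ∈ 𝔤, conjR u X ∈ 𝔤) {U : Site d → Fin d → 𝔸ˣ} (hU : ∀ x κ, U x κ ∈ H)
    (yc : o → Site d) (κc : o → Fin d) {ε : ℝ} (hε0 : 0 ≤ ε) (hε : ε ≤ 1 / 8)
    (hW : ∀ c (r : Fin d → Fin L), ‖((Wcx L U (corner L (yc c)) (κc c) (boxVec L r) : 𝔸ˣ) : 𝔸) - 1‖ ≤ ε)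
    (hsmall : 50 * (d + 1) * ε < (((L : ℝ) ^ d)⁻¹))
    (hW1 : ∀ c (r : Fin d → Fin L), ‖((Wcx L U (corner L (yc c)) (κc c) (boxVec L r) : 𝔸ˣ) : 𝔸) - 1‖ < 1)
    (h𝔤 : ∀ c, ∀ X ∈ 𝔤, fullCoeff L U (yc c) (κc c) X ∈ 𝔤)
    (hW1' : ∀ c (r : Fin d → Fin L),
      ‖((Wcx L (1 : Site d → Fin d → 𝔸ˣ) (corner L (yc c)) (κc c) (boxVec L r) : 𝔸ˣ) : 𝔸) - 1‖ < 1)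
    (h𝔤' : ∀ c, ∀ X ∈ 𝔤, fullCoeff L (1 : Site d → Fin d → 𝔸ˣ) (yc c) (κc c) X ∈ 𝔤)
    {n m r : ℕ} (Z₁ Z₀ : Beta.ConstrainedGaussian n m) (e₁ e₀ : Fin n ≃ Fin r ⊕ Fin m) (em : Fin m ≃ ι × o)
    (hS₁ : Matrix.reindex em em (Z₁.constraintEliminated e₁)
      = Matrix.blockDiagonal fun c => LinearMap.toMatrix b b (fullCoeffOn L 𝔤 U (yc c) (κc c) (hW1 c) (h𝔤 c)))
    (hS₀ : Matrix.reindex em em (Z₀.constraintEliminated e₀)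
      = Matrix.blockDiagonal fun c =>
          LinearMap.toMatrix b b (fullCoeffOn L 𝔤 (1 : Site d → Fin d → 𝔸ˣ) (yc c) (κc c) (hW1' c) (h𝔤' c)))
    (hC₁ : (Z₁.reduced (Z₁.elimMatrix e₁)).PosDef) (hC₀ : (Z₀.reduced (Z₀.elimMatrix e₀)).PosDef) :
    |(Z₁.logZ - Z₀.logZ)
        - (Real.log (Zk (volume : Measure (Fin r → ℝ)) (Matrix.toLinearMap₂' ℝ (Z₁.reduced (Z₁.elimMatrix e₁))))
            - Real.log (Zk (volume : Measure (Fin r → ℝ)) (Matrix.toLinearMap₂' ℝ (Z₀.reduced (Z₀.elimMatrix e₀)))))|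
      ≤ Fintype.card o * (Module.finrank ℝ 𝔤
          * (50 * (d + 1) * ε * (L : ℝ) ^ d / (1 - 50 * (d + 1) * ε * (L : ℝ) ^ d))) := by
  have hsmall0 : 50 * (d + 1) * (0 : ℝ) < (((L : ℝ) ^ d)⁻¹) := by
    rw [mul_zero]; exact inv_pos.2 (by positivity)
  -- the blocks are invertible: `det S(U, b₀(c)) ≠ 0` (positivity of `|det|`), `det S(1, b₀(c)) ≠ 0`
  have hd₁ : ∀ c, (LinearMap.toMatrix b b (fullCoeffOn L 𝔤 U (yc c) (κc c) (hW1 c) (h𝔤 c))).det ≠ 0 := fun c => by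
    rw [LinearMap.det_toMatrix]
    have h := abs_det_fullCoeffOn_eq hL 𝔤 hH hst hU (yc c) (κc c) hε0 hε (hW c) hsmall (hW1 c) (h𝔤 c)
    have hpos : 0 < |LinearMap.det (fullCoeffOn L 𝔤 U (yc c) (κc c) (hW1 c) (h𝔤 c))| := by
      rw [h]
      have hLpos : (0 : ℝ) < L := by exact_mod_cast hL
      exact mul_pos (mul_pos (pow_pos hLpos _) (pow_pos (inv_pos.2 (pow_pos hLpos _)) _))
        (det_relCoeffOn_pos hL 𝔤 hH hst hU (yc c) (κc c) hε0 hε (hW c) hsmall (hW1 c) (h𝔤 c))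
    exact abs_pos.1 hpos
  have hd₀ : ∀ c, (LinearMap.toMatrix b b
      (fullCoeffOn L 𝔤 (1 : Site d → Fin d → 𝔸ˣ) (yc c) (κc c) (hW1' c) (h𝔤' c))).det ≠ 0 := fun c => by
    rw [LinearMap.det_toMatrix]
    have h := abs_det_fullCoeffOn_eq hL 𝔤 hH hst (V₀ := 1) (fun _ _ => H.one_mem) (yc c) (κc c) le_rfl
      (by norm_num) (norm_Wcx_one_sub_one_le le_rfl (corner L (yc c)) (κc c)) hsmall0 (hW1' c) (h𝔤' c)
    have hpos : 0 < |LinearMap.det (fullCoeffOn L 𝔤 (1 : Site d → Fin d → 𝔸ˣ) (yc c) (κc c) (hW1' c) (h𝔤' c))| := by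
      rw [h]
      have hLpos : (0 : ℝ) < L := by exact_mod_cast hL
      exact mul_pos (mul_pos (pow_pos hLpos _) (pow_pos (inv_pos.2 (pow_pos hLpos _)) _))
        (det_relCoeffOn_pos hL 𝔤 hH hst (fun _ _ => H.one_mem) (yc c) (κc c) le_rfl (by norm_num)
          (norm_Wcx_one_sub_one_le le_rfl (corner L (yc c)) (κc c)) hsmall0 (hW1' c) (h𝔤' c))
    exact abs_pos.1 hpos
  have hκ₁ : (Z₁.constraintEliminated e₁).det ≠ 0 := det_ne_zero_of_blockDiagonal _ em _ hS₁ hd₁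
  have hκ₀ : (Z₀.constraintEliminated e₀).det ≠ 0 := det_ne_zero_of_blockDiagonal _ em _ hS₀ hd₀
  rw [logZ_sub_logZ_eq Z₁ Z₀ e₁ e₀ hκ₁ hκ₀ hC₁ hC₀, log_abs_det_eq_sum_of_blockDiagonal _ em _ hS₁ hd₁,
    log_abs_det_eq_sum_of_blockDiagonal _ em _ hS₀ hd₀, sub_sub_cancel_left, abs_neg, ← Finset.sum_sub_distrib]
  have hsum := abs_sum_neg_log_abs_det_sub_flat_le (Finset.univ : Finset o) hL 𝔤 hH hst hU yc κc hε0 hε hW hsmall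
    hW1 h𝔤 hW1' h𝔤'
  rw [Finset.card_univ] at hsum
  have heq : ∑ c, (Real.log |(LinearMap.toMatrix b b (fullCoeffOn L 𝔤 U (yc c) (κc c) (hW1 c) (h𝔤 c))).det|
        - Real.log |(LinearMap.toMatrix b b
            (fullCoeffOn L 𝔤 (1 : Site d → Fin d → 𝔸ˣ) (yc c) (κc c) (hW1' c) (h𝔤' c))).det|)
      = -∑ c, (-Real.log |LinearMap.det (fullCoeffOn L 𝔤 U (yc c) (κc c) (hW1 c) (h𝔤 c))|
          - (-Real.log |LinearMap.det (fullCoeffOn L 𝔤 (1 : Site d → Fin d → 𝔸ˣ) (yc c) (κc c) (hW1' c) (h𝔤' c))|)) := by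
    rw [← Finset.sum_neg_distrib]
    refine Finset.sum_congr rfl fun c _ => ?_
    rw [LinearMap.det_toMatrix, LinearMap.det_toMatrix]
    ring
  rw [heq, abs_neg]
  exact hsum

end Bracket


/-! ## §11 (v1.2) Log-charted gauge groups and `G = SU(N)` (print's semi-simple compact case, [B10] Thm. 1): the size of
`−log det S` with the `𝔤`-hypotheses discharged by `B10Eq61CoefficientOnLie` ∕ `B10Eq61DetPositive` -/

section ChartAndSpecialUnitary

open scoped Matrix.Norms.L2Operator
open B7Prop1Explicit B7Prop3GeneralRotated B7Eq125RightInverse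
open B7Eq78Linearization (conjR)
open B7Prop2Explicit (hol_mem_of)
open B7Prop2SpecialUnitary (specialUnitaryUnits mem_specialUnitaryUnits specialUnitaryUnits_le_U1)
open B10Eq61SpineCoefficient (fullCoeff fullCoeffOn)
open B10Eq61CoefficientOnLie (fullCoeff_mem_lie expUnit_mem_of_logChart)
open B10Eq61DetPositive (det_fullCoeffOn_pos_specialUnitary)

variable {d : ℕ}

section Chart

variable {𝔸 : Type*} [NormedRing 𝔸] [NormedAlgebra ℂ 𝔸] [NormOneClass 𝔸] [CompleteSpace 𝔸]
variable {L : ℕ} {H : Subgroup 𝔸ˣ}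

/-- **THE SIZE OF THE LOCAL TERM ON THE LIE ALGEBRA OF A LOG-CHARTED GAUGE GROUP** `G` (p24's `LogChart`; `H ≤ U1` its
group of units, generated by `e^𝔤`, `hexp` = [4] p. 20), at an `H`-valued background regular at `c` (block loops within
`ε ≦ 1/8`, `50(d+1)ε < L^{−d}`, and within `ρ_G`): `|−log det S(V₀, b₀(c))|_𝔤 − (d − 1)·dim 𝔤·log L| ≦ dim 𝔤·θ/(1 − θ)`,
`θ = 50(d+1)εL^{d}` — `S𝔤 ⊆ 𝔤`, `Ad(H)𝔤 ⊆ 𝔤`, `e^𝔤 ⊆ H` supplied by `B10Eq61CoefficientOnLie`.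
[cite: Balaban1985UV3, p.271 (after (62)); Balaban1985Averaging, p.20, (124)–(126) p.36; Hall2015, Thm. 3.42] -/
theorem abs_neg_log_det_fullCoeffOn_sub_le_div_of_logChart (hL : 1 ≤ L) (G : LogChart 𝔸) [FiniteDimensional ℝ G.lie]
    (hHG : ∀ u : 𝔸ˣ, u ∈ H ↔ (u : 𝔸) ∈ G.carrier) (hH : H ≤ U1 𝔸)
    (hexp : ∀ u : 𝔸ˣ, u ∈ H → ∃ X ∈ G.lie, expUnit X = u)
    {V₀ : Site d → Fin d → 𝔸ˣ} (hV₀ : ∀ z μ, V₀ z μ ∈ H) (y : Site d) (κ : Fin d) {ε : ℝ} (hε0 : 0 ≤ ε) (hε : ε ≤ 1 / 8)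
    (hW : ∀ r : Fin d → Fin L, ‖((Wcx L V₀ (corner L y) κ (boxVec L r) : 𝔸ˣ) : 𝔸) - 1‖ ≤ ε)
    (hsmall : 50 * (d + 1) * ε < (((L : ℝ) ^ d)⁻¹))
    (hW1 : ∀ r : Fin d → Fin L, ‖((Wcx L V₀ (corner L y) κ (boxVec L r) : 𝔸ˣ) : 𝔸) - 1‖ < 1)
    (hWρ : ∀ r : Fin d → Fin L, ‖((Wcx L V₀ (corner L y) κ (boxVec L r) : 𝔸ˣ) : 𝔸) - 1‖ < G.ρ) :
    |-Real.log (LinearMap.det (fullCoeffOn L G.lie V₀ y κ hW1 (fullCoeff_mem_lie G hHG hV₀ y κ hW1 hWρ)))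
        - ((d : ℝ) - 1) * Module.finrank ℝ G.lie * Real.log L|
      ≤ Module.finrank ℝ G.lie * (50 * (d + 1) * ε * (L : ℝ) ^ d / (1 - 50 * (d + 1) * ε * (L : ℝ) ^ d)) :=
  abs_neg_log_det_fullCoeffOn_sub_le_div hL G.lie hH (G.conjR_mem_lie hHG) (expUnit_mem_of_logChart G hHG) hexp hV₀ y κ
    hε0 hε hW hsmall hW1 _

end Chart

section SpecialUnitary

variable {n : Type*} [Fintype n] [DecidableEq n] [Nonempty n]
variable {L : ℕ}

/-- **THE SIZE OF THE LOCAL TERM FOR `SU(N)`-VALUED BACKGROUNDS** regular at `c` (block loops within `ε ≦ 1/8` of `1`,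
`50(d+1)ε < L^{−d}`, and within the `SU(N)` chart radius `min(1/3, 3/N)` of the tree's `specialUnitaryLogChart`):
`|−log det S(V₀, b₀(c))|_{𝔰𝔲(N)} − (d − 1)·dim 𝔰𝔲(N)·log L| ≦ dim 𝔰𝔲(N)·θ/(1 − θ)`, `θ = 50(d+1)εL^{d}` — print's
semi-simple compact case; `det S > 0` there by `B10Eq61DetPositive.det_fullCoeffOn_pos_specialUnitary` (square roots
taken in `U(N)`), so the `det` reading reduces to §4's `|det|` bound with `H = SU(N) ≤ U1`.
[cite: Balaban1985UV3, Thm. 1 p.257, p.271 (after (62)); Balaban1985Averaging, p.20, (23) p.21, (124)–(126) p.36] -/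
theorem abs_neg_log_det_fullCoeffOn_sub_le_div_specialUnitary (hL : 1 ≤ L) {V₀ : Site d → Fin d → (Matrix n n ℂ)ˣ}
    (hV₀ : ∀ z μ, V₀ z μ ∈ specialUnitaryUnits n) (y : Site d) (κ : Fin d) {ε : ℝ} (hε0 : 0 ≤ ε)
    (hε : ε ≤ 1 / 8)
    (hW : ∀ r : Fin d → Fin L, ‖((Wcx L V₀ (corner L y) κ (boxVec L r) : (Matrix n n ℂ)ˣ) : Matrix n n ℂ) - 1‖ ≤ ε)
    (hsmall : 50 * (d + 1) * ε < (((L : ℝ) ^ d)⁻¹))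
    (hW1 : ∀ r : Fin d → Fin L, ‖((Wcx L V₀ (corner L y) κ (boxVec L r) : (Matrix n n ℂ)ˣ) : Matrix n n ℂ) - 1‖ < 1)
    (hWρ : ∀ r : Fin d → Fin L,
      ‖((Wcx L V₀ (corner L y) κ (boxVec L r) : (Matrix n n ℂ)ˣ) : Matrix n n ℂ) - 1‖
        < min (1 / 3) (3 / (Fintype.card n : ℝ))) :
    |-Real.log (LinearMap.det (fullCoeffOn L (specialUnitaryLogChart n).lie V₀ y κ hW1
          (fullCoeff_mem_lie (H := specialUnitaryUnits n) (specialUnitaryLogChart n) (fun _ => mem_specialUnitaryUnits)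
            hV₀ y κ hW1 hWρ)))
        - ((d : ℝ) - 1) * Module.finrank ℝ (specialUnitaryLogChart n).lie * Real.log L|
      ≤ Module.finrank ℝ (specialUnitaryLogChart n).lie
          * (50 * (d + 1) * ε * (L : ℝ) ^ d / (1 - 50 * (d + 1) * ε * (L : ℝ) ^ d)) := by
  letI : CStarAlgebra (Matrix n n ℂ) := {}
  rw [← abs_of_pos (det_fullCoeffOn_pos_specialUnitary hL hV₀ y κ hε0 hε hW hsmall hW1 hWρ)]
  exact abs_neg_log_abs_det_fullCoeffOn_sub_le_div (H := specialUnitaryUnits n) hL _ specialUnitaryUnits_le_U1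
    ((specialUnitaryLogChart n).conjR_mem_lie fun _ => mem_specialUnitaryUnits) hV₀ y κ hε0 hε hW hsmall hW1 _

end SpecialUnitary

end ChartAndSpecialUnitary


/-! ## §12 (v1.3) The size of `log Z^{(k)}(·, U)` itself — per integration variable and per coarse bond
([B10] p. 273 «we get easily |E^{(j)}| ≦ O(1)|T₁^{(j)}|» for the `log Z^{(k)}(T₁^{(k)}, 1)` term of (62); the `J` of
`B10Eq65PolymerSum.logZT_le_of_gaussian` is EXACT at the flat background) -/

section Volume

open MeasureTheory B7Prop1Explicit B7Prop3GeneralRotated B7Eq125RightInverse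
open B7Eq78Linearization (conjR)
open B10Eq55GaussianStep B10Eq61EliminationTerms
open B10Eq61SpineCoefficient (fullCoeff fullCoeffOn)
open scoped Matrix

variable {d : ℕ}
variable {𝔸 : Type*} [NormedRing 𝔸] [NormedAlgebra ℂ 𝔸] [NormOneClass 𝔸] [CompleteSpace 𝔸]
variable {L : ℕ}
variable {o : Type*} [Fintype o] [DecidableEq o]

/-- **`log Z^{(k)}(·, 1)` EXACTLY**: for the flat-background constrained normalisation `Z₀ ↦ (Q(1), Δ_k(1))` whose
`κ`-blocks are block-diagonal over the coarse bonds with blocks the matrices of `S(1, b₀(c))`,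
`log Z^{(k)}(·, 1) = (r/2)·log 2π + ½·log det(C₀*Δ_k(1)C₀)⁻¹ + |o|·(d − 1)·dim 𝔤·log L` — absolute constant,
Gaussian logarithm, and the flat local terms (§5, exact).  (62) p. 271: the term `log Z^{(k)}(T₁^{(k)}, 1)` of `E^{(k)}`.
[cite: Balaban1985UV3, (62) p.271, p.271 (after (62)); Balaban1985BackgroundPropagators, (3.157) p.428] -/
theorem logZ_flat_eq (hL : 1 ≤ L) (𝔤 : Submodule ℝ 𝔸) [FiniteDimensional ℝ 𝔤]
    {ι : Type*} [Fintype ι] [DecidableEq ι] (b : Module.Basis ι ℝ 𝔤) {H : Subgroup 𝔸ˣ} (hH : H ≤ U1 𝔸)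
    (hst : ∀ u : 𝔸ˣ, u ∈ H → ∀ X ∈ 𝔤, conjR u X ∈ 𝔤) (yc : o → Site d) (κc : o → Fin d)
    (hW1' : ∀ c (r : Fin d → Fin L),
      ‖((Wcx L (1 : Site d → Fin d → 𝔸ˣ) (corner L (yc c)) (κc c) (boxVec L r) : 𝔸ˣ) : 𝔸) - 1‖ < 1)
    (h𝔤' : ∀ c, ∀ X ∈ 𝔤, fullCoeff L (1 : Site d → Fin d → 𝔸ˣ) (yc c) (κc c) X ∈ 𝔤)
    {n m r : ℕ} (Z₀ : Beta.ConstrainedGaussian n m) (e₀ : Fin n ≃ Fin r ⊕ Fin m) (em : Fin m ≃ ι × o)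
    (hS₀ : Matrix.reindex em em (Z₀.constraintEliminated e₀)
      = Matrix.blockDiagonal fun c =>
          LinearMap.toMatrix b b (fullCoeffOn L 𝔤 (1 : Site d → Fin d → 𝔸ˣ) (yc c) (κc c) (hW1' c) (h𝔤' c)))
    (hC₀ : (Z₀.reduced (Z₀.elimMatrix e₀)).PosDef) :
    Z₀.logZ = (r : ℝ) / 2 * Real.log (2 * Real.pi) + (1 / 2 : ℝ) * Real.log ((Z₀.reduced (Z₀.elimMatrix e₀)).det)⁻¹
      + Fintype.card o * (((d : ℝ) - 1) * Module.finrank ℝ 𝔤 * Real.log L) := by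
  have hd₀ : ∀ c, (LinearMap.toMatrix b b
      (fullCoeffOn L 𝔤 (1 : Site d → Fin d → 𝔸ˣ) (yc c) (κc c) (hW1' c) (h𝔤' c))).det ≠ 0 := fun c => by
    rw [LinearMap.det_toMatrix]
    intro h0
    have hsmall : 50 * (d + 1) * (0 : ℝ) < (((L : ℝ) ^ d)⁻¹) := by
      rw [mul_zero]; exact inv_pos.2 (by positivity)
    have hpos := det_relCoeffOn_pos hL 𝔤 hH hst (fun _ _ => H.one_mem) (yc c) (κc c) le_rfl (by norm_num)
      (norm_Wcx_one_sub_one_le le_rfl (corner L (yc c)) (κc c)) hsmall (hW1' c) (h𝔤' c)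
    have habs := abs_det_fullCoeffOn_eq hL 𝔤 hH hst (V₀ := 1) (fun _ _ => H.one_mem) (yc c) (κc c) le_rfl
      (by norm_num) (norm_Wcx_one_sub_one_le le_rfl (corner L (yc c)) (κc c)) hsmall (hW1' c) (h𝔤' c)
    rw [h0, abs_zero] at habs
    have hLpos : (0 : ℝ) < L := by exact_mod_cast hL
    have : (0 : ℝ) < (L : ℝ) ^ Module.finrank ℝ 𝔤 * (((L : ℝ) ^ d)⁻¹) ^ Module.finrank ℝ 𝔤
        * LinearMap.det (relCoeffOn L 𝔤 hst (fun _ _ => H.one_mem) (yc c) (κc c) (hW1' c) (h𝔤' c)) := by positivity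
    linarith
  rw [logZ_eq_const_add_logDet_sub_sum Z₀ e₀ hC₀ em _ hS₀ hd₀]
  have hsum : ∑ c, Real.log |(LinearMap.toMatrix b b
      (fullCoeffOn L 𝔤 (1 : Site d → Fin d → 𝔸ˣ) (yc c) (κc c) (hW1' c) (h𝔤' c))).det|
      = ∑ _c : o, -(((d : ℝ) - 1) * Module.finrank ℝ 𝔤 * Real.log L) := by
    refine Finset.sum_congr rfl fun c _ => ?_
    rw [LinearMap.det_toMatrix, ← neg_log_abs_det_fullCoeffOn_one hL 𝔤 hH hst (yc c) (κc c) (hW1' c) (h𝔤' c), neg_neg]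
  rw [hsum, Finset.sum_const, Finset.card_univ, nsmul_eq_mul]
  ring

/-- **THE VOLUME LAW FOR `log Z^{(k)}(·, 1)`**: if moreover `γ₀·1 ⪯ C₀*Δ_k(1)C₀ ⪯ γ₁·1` with `γ₀ > 0` ([5] (3.157):
«a positive definite operator C*Δ_kC with a lower bound γ₀ > 0 independent of k and U»; the upper bound is the
boundedness of the lattice operator), then
`|log Z^{(k)}(·, 1)| ≦ r·½(log 2π + max(|log γ₀|, |log γ₁|)) + |o|·|(d − 1)·dim 𝔤·log L|` — a constant per integration
variable plus a constant per coarse bond: the mechanism of p. 273 «we get easily |E^{(j)}| ≦ O(1)|T₁^{(j)}|» for the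
`log Z^{(k)}(T₁^{(k)}, 1)` term of (62), with the elimination constant `J` of `B10Eq65PolymerSum.logZT_le_of_gaussian`
now EXACT (`= |o|·(d − 1)·dim 𝔤·log L`) instead of a hypothesis (`B10Eq35Norm.abs_log_det_le_of_form_bounds` by name).
[cite: Balaban1985UV3, (62) p.271, (65) p.273; Balaban1985BackgroundPropagators, (3.157) p.428] -/
theorem abs_logZ_flat_le (hL : 1 ≤ L) (𝔤 : Submodule ℝ 𝔸) [FiniteDimensional ℝ 𝔤]
    {ι : Type*} [Fintype ι] [DecidableEq ι] (b : Module.Basis ι ℝ 𝔤) {H : Subgroup 𝔸ˣ} (hH : H ≤ U1 𝔸)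
    (hst : ∀ u : 𝔸ˣ, u ∈ H → ∀ X ∈ 𝔤, conjR u X ∈ 𝔤) (yc : o → Site d) (κc : o → Fin d)
    (hW1' : ∀ c (r : Fin d → Fin L),
      ‖((Wcx L (1 : Site d → Fin d → 𝔸ˣ) (corner L (yc c)) (κc c) (boxVec L r) : 𝔸ˣ) : 𝔸) - 1‖ < 1)
    (h𝔤' : ∀ c, ∀ X ∈ 𝔤, fullCoeff L (1 : Site d → Fin d → 𝔸ˣ) (yc c) (κc c) X ∈ 𝔤)
    {n m r : ℕ} (Z₀ : Beta.ConstrainedGaussian n m) (e₀ : Fin n ≃ Fin r ⊕ Fin m) (em : Fin m ≃ ι × o)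
    (hS₀ : Matrix.reindex em em (Z₀.constraintEliminated e₀)
      = Matrix.blockDiagonal fun c =>
          LinearMap.toMatrix b b (fullCoeffOn L 𝔤 (1 : Site d → Fin d → 𝔸ˣ) (yc c) (κc c) (hW1' c) (h𝔤' c)))
    {γ₀ γ₁ : ℝ} (hγ₀ : 0 < γ₀)
    (hlo : ((Z₀.reduced (Z₀.elimMatrix e₀)) - γ₀ • (1 : Matrix (Fin r) (Fin r) ℝ)).PosSemidef)
    (hhi : (γ₁ • (1 : Matrix (Fin r) (Fin r) ℝ) - (Z₀.reduced (Z₀.elimMatrix e₀))).PosSemidef) :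
    |Z₀.logZ| ≤ r * ((Real.log (2 * Real.pi) + max |Real.log γ₀| |Real.log γ₁|) / 2)
      + Fintype.card o * |((d : ℝ) - 1) * Module.finrank ℝ 𝔤 * Real.log L| := by
  set M := Z₀.reduced (Z₀.elimMatrix e₀) with hM
  have hMh : M.IsHermitian := B10Eq35Norm.isHermitian_of_sub_smul_one_posSemidef hlo
  have hlo' := B10Eq35Norm.le_form_of_sub_smul_one_posSemidef hlo
  have hhi' := B10Eq35Norm.form_le_of_smul_one_sub_posSemidef hhi
  have hMpd : M.PosDef := B10Eq35Norm.posDef_of_le_form hMh hγ₀ hlo'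
  have hdet := B10Eq35Norm.abs_log_det_le_of_form_bounds hMh hγ₀ hlo' hhi'
  rw [Fintype.card_fin] at hdet
  rw [logZ_flat_eq hL 𝔤 b hH hst yc κc hW1' h𝔤' Z₀ e₀ em hS₀ hMpd]
  have hr : (0 : ℝ) ≤ r := Nat.cast_nonneg _
  have ho : (0 : ℝ) ≤ Fintype.card o := Nat.cast_nonneg _
  have h2π : 0 ≤ Real.log (2 * Real.pi) := B10Eq35Norm.log_two_pi_nonneg
  have hdet' : |(1 / 2 : ℝ) * Real.log (M.det)⁻¹| ≤ r * (max |Real.log γ₀| |Real.log γ₁| / 2) := by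
    rw [Real.log_inv, abs_mul, abs_neg, abs_of_nonneg (by norm_num : (0 : ℝ) ≤ 1 / 2)]
    linarith
  set A : ℝ := (r : ℝ) / 2 * Real.log (2 * Real.pi) with hA
  set B : ℝ := (1 / 2 : ℝ) * Real.log (M.det)⁻¹ with hB
  set K : ℝ := ((d : ℝ) - 1) * Module.finrank ℝ 𝔤 * Real.log L with hK
  have hA0 : 0 ≤ A := by rw [hA]; positivity
  have h1 : |A + B + Fintype.card o * K| ≤ |A| + |B| + |Fintype.card o * K| :=
    (abs_add_le _ _).trans (by linarith [abs_add_le A B])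
  have h2 : |(Fintype.card o : ℝ) * K| = Fintype.card o * |K| := by rw [abs_mul, abs_of_nonneg ho]
  rw [abs_of_nonneg hA0, h2] at h1
  calc |A + B + Fintype.card o * K| ≤ A + |B| + Fintype.card o * |K| := h1
    _ ≤ A + r * (max |Real.log γ₀| |Real.log γ₁| / 2) + Fintype.card o * |K| := by linarith
    _ = r * ((Real.log (2 * Real.pi) + max |Real.log γ₀| |Real.log γ₁|) / 2) + Fintype.card o * |K| := by
        rw [hA]; ring

/-- **… IN THE SHAPE OF THE `hZ` LEAF** (`B10Assembly.LeafSystem.logZT_le`, `B10Eq65PolymerSum.logZT_le_of_gaussian`):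
with at most `c_T` integration variables and `c_o` coarse bonds per site of `T₁^{(k)}`,
`|log Z^{(k)}(T₁^{(k)}, 1)| ≦ (c_T·½(log 2π + max(|log γ₀|, |log γ₁|)) + c_o·|(d − 1)·dim 𝔤·log L|)·|T₁^{(k)}|` — the
`z` of (65) with its elimination share DERIVED. [cite: Balaban1985UV3, (62) p.271, (65) p.273] -/
theorem abs_logZ_flat_le_sites (hL : 1 ≤ L) (𝔤 : Submodule ℝ 𝔸) [FiniteDimensional ℝ 𝔤]
    {ι : Type*} [Fintype ι] [DecidableEq ι] (b : Module.Basis ι ℝ 𝔤) {H : Subgroup 𝔸ˣ} (hH : H ≤ U1 𝔸)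
    (hst : ∀ u : 𝔸ˣ, u ∈ H → ∀ X ∈ 𝔤, conjR u X ∈ 𝔤) (yc : o → Site d) (κc : o → Fin d)
    (hW1' : ∀ c (r : Fin d → Fin L),
      ‖((Wcx L (1 : Site d → Fin d → 𝔸ˣ) (corner L (yc c)) (κc c) (boxVec L r) : 𝔸ˣ) : 𝔸) - 1‖ < 1)
    (h𝔤' : ∀ c, ∀ X ∈ 𝔤, fullCoeff L (1 : Site d → Fin d → 𝔸ˣ) (yc c) (κc c) X ∈ 𝔤)
    {n m r : ℕ} (Z₀ : Beta.ConstrainedGaussian n m) (e₀ : Fin n ≃ Fin r ⊕ Fin m) (em : Fin m ≃ ι × o)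
    (hS₀ : Matrix.reindex em em (Z₀.constraintEliminated e₀)
      = Matrix.blockDiagonal fun c =>
          LinearMap.toMatrix b b (fullCoeffOn L 𝔤 (1 : Site d → Fin d → 𝔸ˣ) (yc c) (κc c) (hW1' c) (h𝔤' c)))
    {γ₀ γ₁ : ℝ} (hγ₀ : 0 < γ₀)
    (hlo : ((Z₀.reduced (Z₀.elimMatrix e₀)) - γ₀ • (1 : Matrix (Fin r) (Fin r) ℝ)).PosSemidef)
    (hhi : (γ₁ • (1 : Matrix (Fin r) (Fin r) ℝ) - (Z₀.reduced (Z₀.elimMatrix e₀))).PosSemidef)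
    {sites cT co : ℝ} (hr : (r : ℝ) ≤ cT * sites) (ho : (Fintype.card o : ℝ) ≤ co * sites) :
    |Z₀.logZ| ≤ (cT * ((Real.log (2 * Real.pi) + max |Real.log γ₀| |Real.log γ₁|) / 2)
      + co * |((d : ℝ) - 1) * Module.finrank ℝ 𝔤 * Real.log L|) * sites := by
  have h := abs_logZ_flat_le hL 𝔤 b hH hst yc κc hW1' h𝔤' Z₀ e₀ em hS₀ hγ₀ hlo hhi
  have hu : 0 ≤ (Real.log (2 * Real.pi) + max |Real.log γ₀| |Real.log γ₁|) / 2 := by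
    have h1 : 0 ≤ max |Real.log γ₀| |Real.log γ₁| := (abs_nonneg _).trans (le_max_left _ _)
    have h2 := B10Eq35Norm.log_two_pi_nonneg
    positivity
  have hv : 0 ≤ |((d : ℝ) - 1) * Module.finrank ℝ 𝔤 * Real.log L| := abs_nonneg _
  calc |Z₀.logZ| ≤ r * ((Real.log (2 * Real.pi) + max |Real.log γ₀| |Real.log γ₁|) / 2)
        + Fintype.card o * |((d : ℝ) - 1) * Module.finrank ℝ 𝔤 * Real.log L| := h
    _ ≤ cT * sites * ((Real.log (2 * Real.pi) + max |Real.log γ₀| |Real.log γ₁|) / 2)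
        + co * sites * |((d : ℝ) - 1) * Module.finrank ℝ 𝔤 * Real.log L| :=
        add_le_add (mul_le_mul_of_nonneg_right hr hu) (mul_le_mul_of_nonneg_right ho hv)
    _ = (cT * ((Real.log (2 * Real.pi) + max |Real.log γ₀| |Real.log γ₁|) / 2)
        + co * |((d : ℝ) - 1) * Module.finrank ℝ 𝔤 * Real.log L|) * sites := by ring

/-- **THE VOLUME LAW FOR `log Z^{(k)}(·, U_{k+1})` AT A REGULAR BACKGROUND**: with the full-coefficient blocks of an
`H ≤ U1`-valued background regular at every coarse bond and `γ₀·1 ⪯ C₁*Δ_k(U)C₁ ⪯ γ₁·1`,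
`|log Z^{(k)}(·, U)| ≦ r·½(log 2π + max(|log γ₀|, |log γ₁|)) + |o|·(|(d − 1)·dim 𝔤·log L| + dim 𝔤·θ/(1 − θ))`,
`θ = 50(d+1)εL^{d}` — per coarse bond the flat constant plus the first-order size of `−log det W`.
[cite: Balaban1985UV3, (61)–(62) p.271, (65) p.273; Balaban1985BackgroundPropagators, (3.157) p.428 («γ₀ > 0 independent of k and U»)] -/
theorem abs_logZ_le (hL : 1 ≤ L) (𝔤 : Submodule ℝ 𝔸) [FiniteDimensional ℝ 𝔤]
    {ι : Type*} [Fintype ι] [DecidableEq ι] (b : Module.Basis ι ℝ 𝔤) {H : Subgroup 𝔸ˣ} (hH : H ≤ U1 𝔸)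
    (hst : ∀ u : 𝔸ˣ, u ∈ H → ∀ X ∈ 𝔤, conjR u X ∈ 𝔤) {U : Site d → Fin d → 𝔸ˣ} (hU : ∀ x κ, U x κ ∈ H)
    (yc : o → Site d) (κc : o → Fin d) {ε : ℝ} (hε0 : 0 ≤ ε) (hε : ε ≤ 1 / 8)
    (hW : ∀ c (r : Fin d → Fin L), ‖((Wcx L U (corner L (yc c)) (κc c) (boxVec L r) : 𝔸ˣ) : 𝔸) - 1‖ ≤ ε)
    (hsmall : 50 * (d + 1) * ε < (((L : ℝ) ^ d)⁻¹))
    (hW1 : ∀ c (r : Fin d → Fin L), ‖((Wcx L U (corner L (yc c)) (κc c) (boxVec L r) : 𝔸ˣ) : 𝔸) - 1‖ < 1)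
    (h𝔤 : ∀ c, ∀ X ∈ 𝔤, fullCoeff L U (yc c) (κc c) X ∈ 𝔤)
    {n m r : ℕ} (Z₁ : Beta.ConstrainedGaussian n m) (e₁ : Fin n ≃ Fin r ⊕ Fin m) (em : Fin m ≃ ι × o)
    (hS₁ : Matrix.reindex em em (Z₁.constraintEliminated e₁)
      = Matrix.blockDiagonal fun c => LinearMap.toMatrix b b (fullCoeffOn L 𝔤 U (yc c) (κc c) (hW1 c) (h𝔤 c)))
    {γ₀ γ₁ : ℝ} (hγ₀ : 0 < γ₀)
    (hlo : ((Z₁.reduced (Z₁.elimMatrix e₁)) - γ₀ • (1 : Matrix (Fin r) (Fin r) ℝ)).PosSemidef)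
    (hhi : (γ₁ • (1 : Matrix (Fin r) (Fin r) ℝ) - (Z₁.reduced (Z₁.elimMatrix e₁))).PosSemidef) :
    |Z₁.logZ| ≤ r * ((Real.log (2 * Real.pi) + max |Real.log γ₀| |Real.log γ₁|) / 2)
      + Fintype.card o * (|((d : ℝ) - 1) * Module.finrank ℝ 𝔤 * Real.log L|
          + Module.finrank ℝ 𝔤 * (50 * (d + 1) * ε * (L : ℝ) ^ d / (1 - 50 * (d + 1) * ε * (L : ℝ) ^ d))) := by
  set M := Z₁.reduced (Z₁.elimMatrix e₁) with hM
  have hMh : M.IsHermitian := B10Eq35Norm.isHermitian_of_sub_smul_one_posSemidef hlo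
  have hlo' := B10Eq35Norm.le_form_of_sub_smul_one_posSemidef hlo
  have hhi' := B10Eq35Norm.form_le_of_smul_one_sub_posSemidef hhi
  have hMpd : M.PosDef := B10Eq35Norm.posDef_of_le_form hMh hγ₀ hlo'
  have hdet := B10Eq35Norm.abs_log_det_le_of_form_bounds hMh hγ₀ hlo' hhi'
  rw [Fintype.card_fin] at hdet
  have hLpos : (0 : ℝ) < L := by exact_mod_cast hL
  -- the blocks: `log|det S_c(U)| = −[(d−1)·n·log L − log det W_c]`, `|log det W_c| ≤ n·θ/(1−θ)`
  have hd₁ : ∀ c, (LinearMap.toMatrix b b (fullCoeffOn L 𝔤 U (yc c) (κc c) (hW1 c) (h𝔤 c))).det ≠ 0 := fun c => by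
    rw [LinearMap.det_toMatrix]
    have h := abs_det_fullCoeffOn_eq hL 𝔤 hH hst hU (yc c) (κc c) hε0 hε (hW c) hsmall (hW1 c) (h𝔤 c)
    have hpos : 0 < |LinearMap.det (fullCoeffOn L 𝔤 U (yc c) (κc c) (hW1 c) (h𝔤 c))| := by
      rw [h]
      exact mul_pos (mul_pos (pow_pos hLpos _) (pow_pos (inv_pos.2 (pow_pos hLpos _)) _))
        (det_relCoeffOn_pos hL 𝔤 hH hst hU (yc c) (κc c) hε0 hε (hW c) hsmall (hW1 c) (h𝔤 c))
    exact abs_pos.1 hpos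
  have hblk : ∀ c, |(Real.log |(LinearMap.toMatrix b b (fullCoeffOn L 𝔤 U (yc c) (κc c) (hW1 c) (h𝔤 c))).det|)|
      ≤ |((d : ℝ) - 1) * Module.finrank ℝ 𝔤 * Real.log L|
        + Module.finrank ℝ 𝔤 * (50 * (d + 1) * ε * (L : ℝ) ^ d / (1 - 50 * (d + 1) * ε * (L : ℝ) ^ d)) := fun c => by
    rw [LinearMap.det_toMatrix]
    have h1 := neg_log_abs_det_fullCoeffOn_eq hL 𝔤 hH hst hU (yc c) (κc c) hε0 hε (hW c) hsmall (hW1 c) (h𝔤 c)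
    have h2 := abs_log_det_relCoeffOn_le_div hL 𝔤 hH hst hU (yc c) (κc c) hε0 hε (hW c) hsmall (hW1 c) (h𝔤 c)
    have h3 : Real.log |LinearMap.det (fullCoeffOn L 𝔤 U (yc c) (κc c) (hW1 c) (h𝔤 c))|
        = -(((d : ℝ) - 1) * Module.finrank ℝ 𝔤 * Real.log L)
          + Real.log (LinearMap.det (relCoeffOn L 𝔤 hst hU (yc c) (κc c) (hW1 c) (h𝔤 c))) := by linarith
    rw [h3]
    calc |-(((d : ℝ) - 1) * Module.finrank ℝ 𝔤 * Real.log L)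
          + Real.log (LinearMap.det (relCoeffOn L 𝔤 hst hU (yc c) (κc c) (hW1 c) (h𝔤 c)))|
        ≤ |-(((d : ℝ) - 1) * Module.finrank ℝ 𝔤 * Real.log L)|
          + |Real.log (LinearMap.det (relCoeffOn L 𝔤 hst hU (yc c) (κc c) (hW1 c) (h𝔤 c)))| := abs_add_le _ _
      _ ≤ _ := by rw [abs_neg]; linarith
  rw [logZ_eq_const_add_logDet_sub_sum Z₁ e₁ hMpd em _ hS₁ hd₁]
  have hr : (0 : ℝ) ≤ r := Nat.cast_nonneg _
  have h2π : 0 ≤ Real.log (2 * Real.pi) := B10Eq35Norm.log_two_pi_nonneg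
  have hdet' : |(1 / 2 : ℝ) * Real.log (M.det)⁻¹| ≤ r * (max |Real.log γ₀| |Real.log γ₁| / 2) := by
    rw [Real.log_inv, abs_mul, abs_neg, abs_of_nonneg (by norm_num : (0 : ℝ) ≤ 1 / 2)]
    linarith
  have hsum := Finset.sum_le_card_nsmul (Finset.univ : Finset o)
    (fun c => |(Real.log |(LinearMap.toMatrix b b (fullCoeffOn L 𝔤 U (yc c) (κc c) (hW1 c) (h𝔤 c))).det|)|)
    _ (fun c _ => hblk c)
  rw [Finset.card_univ, nsmul_eq_mul] at hsum
  set T : ℝ := ∑ c, Real.log |(LinearMap.toMatrix b b (fullCoeffOn L 𝔤 U (yc c) (κc c) (hW1 c) (h𝔤 c))).det| with hT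
  have hsum' : |T| ≤ Fintype.card o * (|((d : ℝ) - 1) * Module.finrank ℝ 𝔤 * Real.log L|
          + Module.finrank ℝ 𝔤 * (50 * (d + 1) * ε * (L : ℝ) ^ d / (1 - 50 * (d + 1) * ε * (L : ℝ) ^ d))) :=
    (Finset.abs_sum_le_sum_abs _ _).trans hsum
  set A : ℝ := (r : ℝ) / 2 * Real.log (2 * Real.pi) with hA
  set B : ℝ := (1 / 2 : ℝ) * Real.log (M.det)⁻¹ with hB
  have hA0 : 0 ≤ A := by rw [hA]; positivity
  have h1 : |A + B - T| ≤ |A| + |B| + |T| := (abs_sub _ _).trans (by linarith [abs_add_le A B])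
  rw [abs_of_nonneg hA0] at h1
  calc |A + B - T| ≤ A + |B| + |T| := h1
    _ ≤ A + r * (max |Real.log γ₀| |Real.log γ₁| / 2)
        + Fintype.card o * (|((d : ℝ) - 1) * Module.finrank ℝ 𝔤 * Real.log L|
          + Module.finrank ℝ 𝔤 * (50 * (d + 1) * ε * (L : ℝ) ^ d / (1 - 50 * (d + 1) * ε * (L : ℝ) ^ d))) := by
        linarith
    _ = _ := by rw [hA]; ring

end Volume

/-! ## §13 (v1.4) KNIT TO THE `hZ` LEAF OF (65): `log Z^{(k)}(·, U) = J + log ∫ e^{−½⟨v, C*Δ_k(U)C v⟩} dv` with the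
elimination constant `J = −Σ_c log|det S(U, b₀(c))|` EXPLICIT and BOUNDED — the hypotheses `hZ`, `hJ` of
`B10Eq65PolymerSum.logZT_le_of_gaussian` (p. 273 «we get easily |E^{(j)}| ≦ O(1)|T₁^{(j)}|») PRODUCED, and the volume
law for `log Z^{(k)}(·, U)` re-derived through that leaf by name -/

section LeafKnit

open MeasureTheory B7Prop1Explicit B7Prop3GeneralRotated B7Eq125RightInverse
open B7Eq78Linearization (conjR)
open B10Eq55GaussianStep B10Eq61EliminationTerms
open B10Eq61SpineCoefficient (fullCoeff fullCoeffOn)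
open scoped Matrix

variable {d : ℕ}
variable {𝔸 : Type*} [NormedRing 𝔸] [NormedAlgebra ℂ 𝔸] [NormOneClass 𝔸] [CompleteSpace 𝔸]
variable {L : ℕ}
variable {o : Type*} [Fintype o] [DecidableEq o]

/-- **Per coarse bond**: at a regular `H ≤ U1`-valued background, `|log|det S(V₀, b₀(c))|_𝔤| ≦ |(d − 1)·dim 𝔤·log L| +
dim 𝔤·θ/(1 − θ)` — the flat value (§5) plus the first-order size of `−log det W` (§3).
[cite: Balaban1985UV3, p.271 (after (62)); Balaban1985Averaging, (124)–(126) p.36] -/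
theorem abs_log_abs_det_fullCoeffOn_le (hL : 1 ≤ L) (𝔤 : Submodule ℝ 𝔸) [FiniteDimensional ℝ 𝔤]
    {H : Subgroup 𝔸ˣ} (hH : H ≤ U1 𝔸) (hst : ∀ u : 𝔸ˣ, u ∈ H → ∀ X ∈ 𝔤, conjR u X ∈ 𝔤)
    {V₀ : Site d → Fin d → 𝔸ˣ} (hV₀ : ∀ x κ, V₀ x κ ∈ H) (y : Site d) (κ : Fin d) {ε : ℝ} (hε0 : 0 ≤ ε)
    (hε : ε ≤ 1 / 8) (hW : ∀ r : Fin d → Fin L, ‖((Wcx L V₀ (corner L y) κ (boxVec L r) : 𝔸ˣ) : 𝔸) - 1‖ ≤ ε)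
    (hsmall : 50 * (d + 1) * ε < (((L : ℝ) ^ d)⁻¹))
    (hW1 : ∀ r : Fin d → Fin L, ‖((Wcx L V₀ (corner L y) κ (boxVec L r) : 𝔸ˣ) : 𝔸) - 1‖ < 1)
    (h𝔤 : ∀ X ∈ 𝔤, fullCoeff L V₀ y κ X ∈ 𝔤) :
    |(Real.log |LinearMap.det (fullCoeffOn L 𝔤 V₀ y κ hW1 h𝔤)|)|
      ≤ |((d : ℝ) - 1) * Module.finrank ℝ 𝔤 * Real.log L|
        + Module.finrank ℝ 𝔤 * (50 * (d + 1) * ε * (L : ℝ) ^ d / (1 - 50 * (d + 1) * ε * (L : ℝ) ^ d)) := by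
  have h1 := neg_log_abs_det_fullCoeffOn_eq hL 𝔤 hH hst hV₀ y κ hε0 hε hW hsmall hW1 h𝔤
  have h2 := abs_log_det_relCoeffOn_le_div hL 𝔤 hH hst hV₀ y κ hε0 hε hW hsmall hW1 h𝔤
  have h3 : Real.log |LinearMap.det (fullCoeffOn L 𝔤 V₀ y κ hW1 h𝔤)|
      = -(((d : ℝ) - 1) * Module.finrank ℝ 𝔤 * Real.log L)
        + Real.log (LinearMap.det (relCoeffOn L 𝔤 hst hV₀ y κ hW1 h𝔤)) := by linarith
  rw [h3]
  calc |-(((d : ℝ) - 1) * Module.finrank ℝ 𝔤 * Real.log L)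
        + Real.log (LinearMap.det (relCoeffOn L 𝔤 hst hV₀ y κ hW1 h𝔤))|
      ≤ |-(((d : ℝ) - 1) * Module.finrank ℝ 𝔤 * Real.log L)|
        + |Real.log (LinearMap.det (relCoeffOn L 𝔤 hst hV₀ y κ hW1 h𝔤))| := abs_add_le _ _
    _ ≤ _ := by rw [abs_neg]; linarith

/-- **`hZ` PRODUCED**: for the constrained normalisation `Z₁ ↦ (Q(U), Δ_k(U))` whose `κ`-blocks are block-diagonal over
the coarse bonds with blocks the matrices of `S(U, b₀(c))` (regular `U1`-valued background) and with `C₁*Δ_k(U)C₁`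
positive definite, `log Z^{(k)}(·, U) = J + log ∫ e^{−½⟨v, C₁*Δ_k(U)C₁ v⟩} dv` with the elimination constant
`J = −Σ_c log|det S(U, b₀(c))|` — exactly the hypothesis `hZ` of `B10Eq65PolymerSum.logZT_le_of_gaussian`
(`B10Eq61EliminationTerms.logZ_eq_const_add_logDet_sub_sum` + `Beta.GaussianIntegral.log_integral_exp_neg_half_quadForm`;
block invertibility by `B10Eq61SpineCoefficient.det_fullCoeffOn_ne_zero`, regular `U1`-valued background).
[cite: Balaban1985UV3, (61)–(62) p.271, (65) p.273] -/
theorem logZ_eq_J_add_log_gaussian (hL : 1 ≤ L) (𝔤 : Submodule ℝ 𝔸) [FiniteDimensional ℝ 𝔤]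
    {ι : Type*} [Fintype ι] [DecidableEq ι] (b : Module.Basis ι ℝ 𝔤) {U : Site d → Fin d → 𝔸ˣ}
    (hU : ∀ x κ, U x κ ∈ U1 𝔸) (yc : o → Site d) (κc : o → Fin d) {ε : ℝ} (hε0 : 0 ≤ ε) (hε : ε ≤ 1 / 8)
    (hW : ∀ c (r : Fin d → Fin L), ‖((Wcx L U (corner L (yc c)) (κc c) (boxVec L r) : 𝔸ˣ) : 𝔸) - 1‖ ≤ ε)
    (hsmall : 50 * (d + 1) * ε < (((L : ℝ) ^ d)⁻¹))
    (hW1 : ∀ c (r : Fin d → Fin L), ‖((Wcx L U (corner L (yc c)) (κc c) (boxVec L r) : 𝔸ˣ) : 𝔸) - 1‖ < 1)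
    (h𝔤 : ∀ c, ∀ X ∈ 𝔤, fullCoeff L U (yc c) (κc c) X ∈ 𝔤)
    {n m r : ℕ} (Z₁ : Beta.ConstrainedGaussian n m) (e₁ : Fin n ≃ Fin r ⊕ Fin m) (em : Fin m ≃ ι × o)
    (hS₁ : Matrix.reindex em em (Z₁.constraintEliminated e₁)
      = Matrix.blockDiagonal fun c => LinearMap.toMatrix b b (fullCoeffOn L 𝔤 U (yc c) (κc c) (hW1 c) (h𝔤 c)))
    (hC₁ : (Z₁.reduced (Z₁.elimMatrix e₁)).PosDef) :
    Z₁.logZ = (-∑ c, Real.log |(LinearMap.toMatrix b b (fullCoeffOn L 𝔤 U (yc c) (κc c) (hW1 c) (h𝔤 c))).det|)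
      + Real.log (∫ v : Fin r → ℝ,
          Real.exp (-(1/2 : ℝ) * (v ⬝ᵥ (Z₁.reduced (Z₁.elimMatrix e₁)) *ᵥ v))) := by
  have hd₁ : ∀ c, (LinearMap.toMatrix b b (fullCoeffOn L 𝔤 U (yc c) (κc c) (hW1 c) (h𝔤 c))).det ≠ 0 := fun c => by
    rw [LinearMap.det_toMatrix]
    exact B10Eq61SpineCoefficient.det_fullCoeffOn_ne_zero hL 𝔤 hU (yc c) (κc c) hε0 hε (hW c) hsmall (hW1 c) (h𝔤 c)
  rw [logZ_eq_const_add_logDet_sub_sum Z₁ e₁ hC₁ em _ hS₁ hd₁,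
    Beta.GaussianIntegral.log_integral_exp_neg_half_quadForm _ hC₁, Fintype.card_fin, Real.log_inv]
  ring

omit [DecidableEq o] in
/-- **`hJ` PRODUCED**: the elimination constant is a constant per coarse bond,
`|J| = |Σ_c log|det S(U, b₀(c))|| ≦ |o|·(|(d − 1)·dim 𝔤·log L| + dim 𝔤·θ/(1 − θ))`, `θ = 50(d+1)εL^{d}`.
[cite: Balaban1985UV3, (62) p.271, (65) p.273] -/
theorem abs_sum_log_abs_det_fullCoeffOn_le (hL : 1 ≤ L) (𝔤 : Submodule ℝ 𝔸) [FiniteDimensional ℝ 𝔤]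
    {ι : Type*} [Fintype ι] [DecidableEq ι] (b : Module.Basis ι ℝ 𝔤) {H : Subgroup 𝔸ˣ} (hH : H ≤ U1 𝔸)
    (hst : ∀ u : 𝔸ˣ, u ∈ H → ∀ X ∈ 𝔤, conjR u X ∈ 𝔤) {U : Site d → Fin d → 𝔸ˣ} (hU : ∀ x κ, U x κ ∈ H)
    (yc : o → Site d) (κc : o → Fin d) {ε : ℝ} (hε0 : 0 ≤ ε) (hε : ε ≤ 1 / 8)
    (hW : ∀ c (r : Fin d → Fin L), ‖((Wcx L U (corner L (yc c)) (κc c) (boxVec L r) : 𝔸ˣ) : 𝔸) - 1‖ ≤ ε)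
    (hsmall : 50 * (d + 1) * ε < (((L : ℝ) ^ d)⁻¹))
    (hW1 : ∀ c (r : Fin d → Fin L), ‖((Wcx L U (corner L (yc c)) (κc c) (boxVec L r) : 𝔸ˣ) : 𝔸) - 1‖ < 1)
    (h𝔤 : ∀ c, ∀ X ∈ 𝔤, fullCoeff L U (yc c) (κc c) X ∈ 𝔤) :
    |(-∑ c, Real.log |(LinearMap.toMatrix b b (fullCoeffOn L 𝔤 U (yc c) (κc c) (hW1 c) (h𝔤 c))).det|)|
      ≤ Fintype.card o * (|((d : ℝ) - 1) * Module.finrank ℝ 𝔤 * Real.log L|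
          + Module.finrank ℝ 𝔤 * (50 * (d + 1) * ε * (L : ℝ) ^ d / (1 - 50 * (d + 1) * ε * (L : ℝ) ^ d))) := by
  have hblk : ∀ c, |(Real.log |(LinearMap.toMatrix b b (fullCoeffOn L 𝔤 U (yc c) (κc c) (hW1 c) (h𝔤 c))).det|)|
      ≤ |((d : ℝ) - 1) * Module.finrank ℝ 𝔤 * Real.log L|
        + Module.finrank ℝ 𝔤 * (50 * (d + 1) * ε * (L : ℝ) ^ d / (1 - 50 * (d + 1) * ε * (L : ℝ) ^ d)) := fun c => by
    rw [LinearMap.det_toMatrix]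
    exact abs_log_abs_det_fullCoeffOn_le hL 𝔤 hH hst hU (yc c) (κc c) hε0 hε (hW c) hsmall (hW1 c) (h𝔤 c)
  have hsum := Finset.sum_le_card_nsmul (Finset.univ : Finset o)
    (fun c => |(Real.log |(LinearMap.toMatrix b b (fullCoeffOn L 𝔤 U (yc c) (κc c) (hW1 c) (h𝔤 c))).det|)|)
    _ (fun c _ => hblk c)
  rw [Finset.card_univ, nsmul_eq_mul] at hsum
  rw [abs_neg]
  exact (Finset.abs_sum_le_sum_abs _ _).trans hsum

/-- **THE VOLUME LAW FOR `log Z^{(k)}(·, U)` THROUGH THE LEAF, BY NAME**: with at most `c_T` integration variables and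
`c_o` coarse bonds per site and `γ₀·1 ⪯ C₁*Δ_k(U)C₁ ⪯ γ₁·1`, `γ₀ > 0`,
`|log Z^{(k)}(·, U)| ≦ (c_T·½(log 2π + max(|log γ₀|, |log γ₁|)) + c_o·(|(d − 1)·dim 𝔤·log L| + dim 𝔤·θ/(1 − θ)))·sites`
— `B10Eq65PolymerSum.logZT_le_of_gaussian` fed with `hZ := logZ_eq_J_add_log_gaussian` and
`hJ := abs_sum_log_abs_det_fullCoeffOn_le`: the `z` of (65) p. 273 with BOTH the Gaussian and the elimination share
derived for the (61)/(62) normalisations. [cite: Balaban1985UV3, (61)–(62) p.271, (65) p.273;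
Balaban1985BackgroundPropagators, (3.157) p.428] -/
theorem abs_logZ_le_sites_of_leaf (hL : 1 ≤ L) (𝔤 : Submodule ℝ 𝔸) [FiniteDimensional ℝ 𝔤]
    {ι : Type*} [Fintype ι] [DecidableEq ι] (b : Module.Basis ι ℝ 𝔤) {H : Subgroup 𝔸ˣ} (hH : H ≤ U1 𝔸)
    (hst : ∀ u : 𝔸ˣ, u ∈ H → ∀ X ∈ 𝔤, conjR u X ∈ 𝔤) {U : Site d → Fin d → 𝔸ˣ} (hU : ∀ x κ, U x κ ∈ H)
    (yc : o → Site d) (κc : o → Fin d) {ε : ℝ} (hε0 : 0 ≤ ε) (hε : ε ≤ 1 / 8)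
    (hW : ∀ c (r : Fin d → Fin L), ‖((Wcx L U (corner L (yc c)) (κc c) (boxVec L r) : 𝔸ˣ) : 𝔸) - 1‖ ≤ ε)
    (hsmall : 50 * (d + 1) * ε < (((L : ℝ) ^ d)⁻¹))
    (hW1 : ∀ c (r : Fin d → Fin L), ‖((Wcx L U (corner L (yc c)) (κc c) (boxVec L r) : 𝔸ˣ) : 𝔸) - 1‖ < 1)
    (h𝔤 : ∀ c, ∀ X ∈ 𝔤, fullCoeff L U (yc c) (κc c) X ∈ 𝔤)
    {n m r : ℕ} (Z₁ : Beta.ConstrainedGaussian n m) (e₁ : Fin n ≃ Fin r ⊕ Fin m) (em : Fin m ≃ ι × o)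
    (hS₁ : Matrix.reindex em em (Z₁.constraintEliminated e₁)
      = Matrix.blockDiagonal fun c => LinearMap.toMatrix b b (fullCoeffOn L 𝔤 U (yc c) (κc c) (hW1 c) (h𝔤 c)))
    {γ₀ γ₁ : ℝ} (hγ₀ : 0 < γ₀)
    (hlo : ((Z₁.reduced (Z₁.elimMatrix e₁)) - γ₀ • (1 : Matrix (Fin r) (Fin r) ℝ)).PosSemidef)
    (hhi : (γ₁ • (1 : Matrix (Fin r) (Fin r) ℝ) - (Z₁.reduced (Z₁.elimMatrix e₁))).PosSemidef)
    {sites cT co : ℝ} (hr : (r : ℝ) ≤ cT * sites) (ho : (Fintype.card o : ℝ) ≤ co * sites) :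
    |Z₁.logZ| ≤ (cT * ((Real.log (2 * Real.pi) + max |Real.log γ₀| |Real.log γ₁|) / 2)
      + co * (|((d : ℝ) - 1) * Module.finrank ℝ 𝔤 * Real.log L|
          + Module.finrank ℝ 𝔤 * (50 * (d + 1) * ε * (L : ℝ) ^ d / (1 - 50 * (d + 1) * ε * (L : ℝ) ^ d)))) * sites := by
  set M := Z₁.reduced (Z₁.elimMatrix e₁) with hM
  have hMh : M.IsHermitian := B10Eq35Norm.isHermitian_of_sub_smul_one_posSemidef hlo
  have hMpd : M.PosDef :=
    B10Eq35Norm.posDef_of_le_form hMh hγ₀ (B10Eq35Norm.le_form_of_sub_smul_one_posSemidef hlo)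
  have hZ := logZ_eq_J_add_log_gaussian hL 𝔤 b (fun x κ => hH (hU x κ)) yc κc hε0 hε hW hsmall hW1 h𝔤 Z₁ e₁ em hS₁
    hMpd
  have hJ := abs_sum_log_abs_det_fullCoeffOn_le hL 𝔤 b hH hst hU yc κc hε0 hε hW hsmall hW1 h𝔤
  have hθ := theta_lt_one hL hsmall
  set K : ℝ := |((d : ℝ) - 1) * Module.finrank ℝ 𝔤 * Real.log L|
      + Module.finrank ℝ 𝔤 * (50 * (d + 1) * ε * (L : ℝ) ^ d / (1 - 50 * (d + 1) * ε * (L : ℝ) ^ d)) with hKdef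
  have hK : 0 ≤ K := by
    have : 0 ≤ 50 * (d + 1) * ε * (L : ℝ) ^ d / (1 - 50 * (d + 1) * ε * (L : ℝ) ^ d) :=
      div_nonneg (by positivity) (by linarith)
    rw [hKdef]; positivity
  have hJ' : |(-∑ c, Real.log |(LinearMap.toMatrix b b (fullCoeffOn L 𝔤 U (yc c) (κc c) (hW1 c) (h𝔤 c))).det|)|
      ≤ co * K * sites :=
    hJ.trans (calc (Fintype.card o : ℝ) * K ≤ co * sites * K := mul_le_mul_of_nonneg_right ho hK
      _ = co * K * sites := by ring)
  have hn : (Fintype.card (Fin r) : ℝ) ≤ cT * sites := by rw [Fintype.card_fin]; exact hr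
  exact B10Eq65PolymerSum.logZT_le_of_gaussian hγ₀ hlo hhi hZ hn hJ'

end LeafKnit

end Literature.MathematicalPhysics.QuantumFieldTheory.Balaban1983to89.B10Eq61LocalTermSize
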